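import Summits.QuantumFields.YangMills.Theorems.BalabanUVNodesN15PerCubeGreenAdjointCubes
import Summits.QuantumFields.YangMills.Theorems.BalabanUVNodesN15CurvedGluingSmoothCutDressedGluedGaugedUN
import Summits.QuantumFields.YangMills.Theorems.BalabanUVNodesN15CurvedGluingSmoothCutDressedAdjointFarDefect
import Summits.QuantumFields.YangMills.Theorems.BalabanUVNodesN15CurvedGluingCubeSmoothCutAdjointLetter
import Summits.QuantumFields.YangMills.Theorems.BalabanUVNodesN15TwoSpacingGluingLocality
import HarnessLib

/-!
# N15 = NE2, road (c) — PROGRAMME (PC), towards (PC-A″) «the THIRD sup-norm entry `G′(U)∇*_U` of [B9] (3.42) in per-cube gauges», II: THE `U(N)` ADJOINT CAPSTONE — n15-c∕280 with the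
# gauges, the covariance identity, the cube perturbation's letter, the ADJOINT letter `𝒲_k`, the two adjoint far rows and the `W`-row DISCHARGED (dag-n15-w3 52's discharges + FILE 150 +
# FILE 166 at the SMOOTH jet cut `C_{χ̃_k}`), its two-sided inverse, and the bound for ANY right inverse of `Δ_{R_U} + P` composed with the right factor (dag-n15-c g27, n15-c∕281)

Cell `pub-ymgap`, seat `pub-ymgap-dag-n15-c` (generation g27; R134 (a), s1 «first missing estimate»; HUMAN RULING D-0062).  `bears_on: R4∕N15 · K3⁸ SpineGivenEndpointR13SepCoPHV
(stmt-QuantumFields-27366)`; filed `--kind proof --supports stmt-QuantumFields-27366 --as helper` — COUNT-NEUTRAL.  Two theorems, 0 `def`, 0 `sorry`.  Imports BY NAME n15-c∕280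
`…PerCubeGreenAdjointCubes` (`hasMaj_gluedL_comp_smoothCutDressed_localGauges_cov`; through it FILE 160 `gluedL_inverse_of_localGauges`, FILE 153 ★★★, FILE 148 `projO_dressedV_comp_lap_mulOp`,
file 34, file 23), dag-n15-w3 52 `…SmoothCutDressedGluedGaugedUN` (through it dag-n15-w2 `uN_localOp_species_form` ∕ `uN_siteGauge_orthogonal`, files 49∕51 `localOp_eq_cut_add_farDefect` ∕
`cutPert_structural_eq` ∕ `hasMaj_cutPert_structural_of_local` ∕ `rowSum_smul_le_of_local`), FILE 166 `…SmoothCutDressedAdjointFarDefect` (`projO_dressedV_comp_farDefect_mulOp`,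
`projO_dressedV_comp_commOp_farDefect`, `mulOp_comp_cutPert_comp_sub_jetCut_comp_jet`, `smoothCut_comp_mulOp_in`, `jetCut_comp_jet_mulOp_comp`), FILE 150 `…CubeSmoothCutAdjointLetter`
(`hasMaj_adjW_smoothCut_loc₂`, `loc₂_le_plain`), n15-c∕279 `…TwoSpacingGluingLocality` (`hasMaj_outLoc_comp_exp`).  Nothing in the tree is modified; nothing restated.

WHY.  n15-c∕280 is FILE 163's adjoint capstone with an abstract right factor `E` of displayed per-cube covariant shape; THIS FILE is its `U(N)` edition in the sense of dag-n15-w3's 52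
(the knit-ready form the SITE instantiation consumes), with ONE design change forced by the adjoint form (g18 FINDING (vi)): the cube perturbation behind the dressed cube is the species of
the transformed bond variables cut on the jet side by the SMOOTH bump `χ̃_k` — `Ṽ_k = M_{ψ_k}(unstackM C A + N_V k∘pr₀)C_{χ̃_k} = unstackM (χ̃_k•C) (χ̃_k•A) + (M_{ψ_k}N_V kM_{χ̃_k})∘pr₀` —
because FILE 150's letter of `𝒲_k` reads the QUOTIENTS of the first-order coefficients, which a sharp cut would make `O(η⁻¹)`; with `χ̃_k` they are `≤ r_D + c̃r_V` from the displayed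
local letters `r_D` of `∇a^±` ((3.35)'s `|∇^ηA|` letter) and `r_V`.  The direct-glued propagator (dag-n15-w3 52 ∕ n15-c∕262's `scGlued`, sharp cut) is a DIFFERENT expansion of the SAME
inverse: theorem III transfers the bound to ANY right inverse `Y` of `Δ_{R_U} + P` — on sites, to the named `G′(U) = cGreen (cvT e U) a` (n15-c∕265∕266).

WHAT.  ★★★ `uN_gluedL_smoothCutDressed_localGauges_cov_spec`: (I) `𝒢_adj∘E ≤ (1 − N_ov|ι|²Θ″c_r)⁻¹N_ov|ι|²(β₂ + β̄′c₁)c_r·e^{−(ρ₃−2σ)d}`, `β₂ = β^Xr_R + β̄′r_{∇R} + β̄′r_B`, `β^X = (1 −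
θ_Ac_r)⁻¹β^Qc_r`, `θ_A = βr_V + |J|·2(β^Qr_V + β(r_D + c̃r_V)) + βR_Nc_r`, `Θ″` = FILE 153's constant at `θ_W = 0` plus the far row `β̄′θ_Fc_r`; AND (II) `𝒢_adj∘(Δ_{R_U} + P) = 1 =
(Δ_{R_U} + P)∘𝒢_adj`.  ★★★ `uN_hasMaj_rightInverse_comp_localGauges_cov`: the bound (I) for `Y∘E`, ANY `Y` with `(Δ_{R_U} + P)∘Y = 1`.

HONEST FRAMING ∕ LIMITS.  Composition of LANDED theorems over DISPLAYED rows on model carriers — the operator-level content of the third entry of (3.42) for Bałaban's covariant operator at a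
genuine non-abelian background with (3.34)–(3.35)'s per-cube gauges, as a CONDITIONAL statement; the gauges `u_k` with the local letters `r_V, r_D` of `u_kUu_kᴴ`, `P`'s conjugation law,
`N_V`'s letters, the flat cube's rows ∕ right entries ∕ right locality and the right factor's covariant shape are HYPOTHESES (site producers: n15-c∕260–264, 220's King rows, 270's law;
the `r_D` letter from `Reg335Cube` is the sequel's); nothing of [B5]∕[B6]∕[B9] asserted ((2.91)–(2.93) p.239, (2.133)–(2.136) p.247, (3.34)–(3.35) p.396, (3.42) p.397, (3.50)–(3.53)
p.400, (3.62)–(3.65) pp.402–403, (3.76)–(3.77) pp.405–406, (3.87)–(3.90) pp.409–410 = SHAPES ∕ MECHANISM).  NE2⁺ NOT PRINTED, NOT proved; N15 of record untouched (DISCHARGED AS CONSUMED,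
p687738); K3⁸ OPEN; counts of record UNMOVED (typed 28∕28 · discharged 8∕27); one finite 𝕋⁴ at fixed ε — NOT infinite volume, NOT OS on ℝ⁴, NOT a mass gap, NOT Clay.  Restate-immune.
-/

set_option autoImplicit false

noncomputable section
open scoped BigOperators Matrix Matrix.Norms.Frobenius
open Finset

namespace Summit.QuantumFields.YangMills.BalabanUVNodes.N15.CurvedSpecies

open Literature.MathematicalPhysics.QuantumFieldTheory.Balaban1983to89
open Literature.MathematicalPhysics.QuantumFieldTheory.Balaban1983to89.B11SectG (BlockNorm HasMaj RowSum hasMaj_zero hasMaj_comp_exp)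
open Literature.MathematicalPhysics.QuantumFieldTheory.Balaban1983to89.B6RandomWalk (Triangle254)
open Literature.MathematicalPhysics.QuantumFieldTheory.Balaban1983to89.B6Prop26Gluing (mulOp mulOp_apply ind ind_nonneg ind_le_one)
open Literature.MathematicalPhysics.QuantumFieldTheory.Balaban1983to89.T4EtaRateCoeffDefect (diagK diagK_nonneg hasMaj_mulOp)
open Summit.QuantumFields.YangMills.BalabanUVNodes.N15.MatrixSpecies (mmulOp liftBlk liftEquiv liftEquiv_apply liftEquiv_symm_apply coordMat)
open Summit.QuantumFields.YangMills.BalabanUVNodes.N15.BackgroundLayer (fgrad bgrad fgradAdj fgrad_apply stack projO blkPair bgPropV covLapM tCoefA tCoefC unstackM projO_none_comp_stack fgradMat)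
open Summit.QuantumFields.YangMills.BalabanUVNodes.N15.Gluing (commOp lapOp parametrix remainder glueInv glueInvL remainderL neumannR isUnit_neumannR commOp_add_left
  hasMaj_gluedL_comp_smoothCutDressed_localGauges_cov gluedL_inverse_of_localGauges hasMaj_smoothCutDressed_comp_commOp_cubeOp_out_of_sandwich projO_dressedV_comp_lap_mulOp
  hasMaj_adjW_smoothCut_loc₂ loc₂_le_plain projO_dressedV_comp_farDefect_mulOp projO_dressedV_comp_commOp_farDefect mulOp_comp_cutPert_comp_sub_jetCut_comp_jet smoothCut_comp_mulOp_in
  hasMaj_outLoc_comp_exp hasMaj_comp_diag mulOp_comp_mulOp_comm exp_rate_mono)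
open Literature.Barriers.QuantumFields (traceForm)

variable {X ι J K : Type} [Fintype X] [DecidableEq X] [Fintype ι] [DecidableEq ι] [Fintype J] [DecidableEq J] [Fintype K] {g : B6.Geometry} (blk : X → g.Site) (τ : J → X ≃ X) (ν : J)
  {σ cr : ℝ} {N : K → (X × ι → ℝ) →ₗ[ℝ] (X × ι → ℝ)} {NL : (X × ι → ℝ) →ₗ[ℝ] (X × ι → ℝ)}
  {χX χtX ψX ψ₂X hX : K → X → ℝ} {Sk : K → Set g.Site} {hb : K → g.Site → ℝ} {Tf Tb : K → J → (X × ι → ℝ) →ₗ[ℝ] (X × ι → ℝ)} {β β₁ ct δ : ℝ}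

set_option maxHeartbeats 1600000 in
/-- ★★★ **A RIGHT FACTOR OF PER-CUBE COVARIANT SHAPE THROUGH THE ADJOINT GLUED OPERATOR OF BAŁABAN's COVARIANT OPERATOR `Δ_{R_U} + P`, EVERY CUBE IN ITS OWN UNITARY SMALL-FIELD
GAUGE — AND THAT OPERATOR INVERTS `Δ_{R_U} + P` ON BOTH SIDES** — n15-c∕280's adjoint capstone and FILE 160's inverse with the gauges' orthogonality (`uN_siteGauge_orthogonal`), the
covariance identity (`uN_localOp_species_form` + `hP` + file 49's split with the SMOOTH jet cut `C_{χ̃_k}`), the cube perturbation's letter (file 51 at `χ̃_k`), the ADJOINT letter `𝒲_k` (FILE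
150, from the row letters `r_V` of the species of the transformed bond variables AND `r_D` of the quotients of its first-order part, where `χ_k ≠ 0`), the TWO adjoint far rows (FILE 166's
identities at `C_{χ̃_k}`: `X_k∘F_k∘M_{h_k} = 0`, `X_k∘[F_k, M_{h_k}] = X_k∘M_{h_k}N_V k(1 − M_{χ̃_k})` and the displayed far letter), the `W`-row (`W = 0`), the right locality `X_k∘Δ^{u_k}∘M_{h_k}
= M_{h_k} + X_k∘F_k∘M_{h_k}` (FILE 148 on the EXACT flat right locality) ALL DISCHARGED.  Displayed: file 44∕63's cube rows, the flat sandwiched right entries, the partition's letters and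
supports, `hP`, the local letters `r_V, r_D`, `N_V k`'s letters, the right factor's Leibniz rule and covariant shape, the smallness conditions.
[cite: Balaban1985BackgroundPropagators, (3.34)–(3.35) p.396, Thm 3.1 (3.42) p.397 (entry `G′(U)∇*_U`: shape), (3.50)–(3.53) p.400, (3.62)–(3.65) pp.402–403, (3.76)–(3.77) pp.405–406, (3.87)–(3.90) pp.409–410, Cor. 3.6 p.408 (mechanism); Balaban1984PropagatorsII, (2.91)–(2.93) p.239, (2.133)–(2.136) p.247 (transposed)] -/
theorem uN_gluedL_smoothCutDressed_localGauges_cov_spec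
    {m : Type} [Fintype m] [DecidableEq m] (e : Matrix m m ℂ ≃L[ℝ] (ι → ℝ)) {u : K → X → Matrix m m ℂ} {U : J → X → Matrix m m ℂ}
    {P : (X × ι → ℝ) →ₗ[ℝ] (X × ι → ℝ)} {NV : K → (X × ι → ℝ) →ₗ[ℝ] (X × ι → ℝ)} (η : ℝ) (htri : Triangle254 g) (hd : ∀ a b : g.Site, 0 ≤ g.dist a b) (hd0 : ∀ y : g.Site, g.dist y y = 0)
    (hsymm : ∀ y y', g.dist y y' = g.dist y' y) (hrow : RowSum g σ cr) (hσ : 0 ≤ σ) {ρ₁ ρ₂ ρ₃ ρN δV ε R c₀ c₁ c₂ cN ℓ ω βQ Nov : ℝ} (hβ : 0 ≤ β) (hβ₁ : 0 ≤ β₁) (hβQ : 0 ≤ βQ) (hct : 0 ≤ ct)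
    (hR : 0 ≤ R) (hcr : 0 ≤ cr) (hNov : 0 ≤ Nov) (hc₀ : 0 ≤ c₀) (hc₁ : 0 ≤ c₁) (hc₂ : 0 ≤ c₂) (hcN : 0 ≤ cN) (hℓ : 0 ≤ ℓ) (hω : 0 ≤ ω) (hε : 0 < ε)
    (hσρ : σ ≤ ρ₁) (hρ₁V : ρ₁ ≤ δV) (hρ₁G : ρ₁ + σ ≤ δ) (hρ₂ : 0 ≤ ρ₂) (hρ₂₁ : ρ₂ + 2 * σ ≤ ρ₁) (hρ₃ : 0 ≤ ρ₃) (hρ₃₂ : ρ₃ + σ ≤ ρ₂) (hρ₃V : ρ₃ + σ ≤ δV - ε) (hρ₃N : ρ₃ + σ ≤ ρN)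
    (hσρ₃ : 2 * σ ≤ ρ₃)
    -- per cube: supports, the bump `χ̃_k` and its insertions, the input cut-offs `ψ_k`, `ψ₂,k`
    (hSχ : ∀ k x, χX k x ≠ 0 → blk x ∈ Sk k) (hSψ : ∀ k x, ψX k x ≠ 0 → blk x ∈ Sk k) (hSψ₂ : ∀ k x, ψ₂X k x ≠ 0 → blk x ∈ Sk k) (hχt : ∀ k x, |χtX k x| ≤ 1) (hχ1 : ∀ k x, |χX k x| ≤ 1)
    (hdχt : ∀ k μ p, |fgrad η⁻¹ (liftEquiv (τ μ) ι) (fun p : X × ι => χtX k p.1) p| ≤ ct) (hdχtb : ∀ k μ p, |bgrad η⁻¹ (liftEquiv (τ μ) ι) (fun p : X × ι => χtX k p.1) p| ≤ ct)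
    (hsub : ∀ k, mulOp (fun p : X × ι => χtX k p.1) ∘ₗ mulOp (fun p : X × ι => χX k p.1) = mulOp (fun p : X × ι => χtX k p.1))
    (hχ : ∀ k, mulOp (fun p : X × ι => χX k p.1) ∘ₗ mulOp (fun p : X × ι => χtX k p.1) = mulOp (fun p : X × ι => χtX k p.1))
    (hs : ∀ k μ, mulOp ((fun p : X × ι => χtX k p.1) ∘ (liftEquiv (τ μ) ι)) ∘ₗ mulOp (fun p : X × ι => χX k p.1) = mulOp ((fun p : X × ι => χtX k p.1) ∘ (liftEquiv (τ μ) ι)))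
    (hsb : ∀ k μ, mulOp ((fun p : X × ι => χtX k p.1) ∘ (liftEquiv (τ μ) ι).symm) ∘ₗ mulOp (fun p : X × ι => χX k p.1) = mulOp ((fun p : X × ι => χtX k p.1) ∘ (liftEquiv (τ μ) ι).symm))
    (hdd : ∀ k μ, mulOp (fgrad η⁻¹ (liftEquiv (τ μ) ι) (fun p : X × ι => χtX k p.1)) ∘ₗ mulOp (fun p : X × ι => χX k p.1) = mulOp (fgrad η⁻¹ (liftEquiv (τ μ) ι) (fun p : X × ι => χtX k p.1)))
    (hddb : ∀ k μ, mulOp (bgrad η⁻¹ (liftEquiv (τ μ) ι) (fun p : X × ι => χtX k p.1)) ∘ₗ mulOp (fun p : X × ι => χX k p.1) = mulOp (bgrad η⁻¹ (liftEquiv (τ μ) ι) (fun p : X × ι => χtX k p.1)))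
    (hNψ : ∀ k, N k ∘ₗ mulOp (fun p : X × ι => ψX k p.1) = N k)
    (hψχ : ∀ k, mulOp (fun p : X × ι => ψX k p.1) ∘ₗ mulOp (fun p : X × ι => χX k p.1) = mulOp (fun p : X × ι => χX k p.1))
    -- per cube: the flat cube's cut rows, its SANDWICHED right entries with rows and input cuts, its EXACT flat right locality on the partition
    (hcut : ∀ k, HasMaj (BlockNorm.ofBlocks g (liftBlk blk ι)) (BlockNorm.ofBlocks g (liftBlk blk ι)) (mulOp (fun p : X × ι => χX k p.1) ∘ₗ N k) (fun y y' => ind (Sk k) y * ind (Sk k) y' * (β * Real.exp (-(δ * g.dist y y')))))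
    (hcutF : ∀ k μ, HasMaj (BlockNorm.ofBlocks g (liftBlk blk ι)) (BlockNorm.ofBlocks g (liftBlk blk ι)) (mulOp (fun p : X × ι => χX k p.1) ∘ₗ (fgrad η⁻¹ (liftEquiv (τ μ) ι) ∘ₗ N k)) (fun y y' => ind (Sk k) y * ind (Sk k) y' * (β₁ * Real.exp (-(δ * g.dist y y')))))
    (hcutB : ∀ k μ, HasMaj (BlockNorm.ofBlocks g (liftBlk blk ι)) (BlockNorm.ofBlocks g (liftBlk blk ι)) (mulOp (fun p : X × ι => χX k p.1) ∘ₗ (bgrad η⁻¹ (liftEquiv (τ μ) ι) ∘ₗ N k)) (fun y y' => ind (Sk k) y * ind (Sk k) y' * (β₁ * Real.exp (-(δ * g.dist y y')))))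
    (hTf : ∀ k μ, N k ∘ₗ fgrad η⁻¹ (liftEquiv (τ μ) ι) ∘ₗ mulOp (fun p : X × ι => χX k p.1) = Tf k μ ∘ₗ mulOp (fun p : X × ι => χX k p.1))
    (hTb : ∀ k μ, N k ∘ₗ bgrad η⁻¹ (liftEquiv (τ μ) ι) ∘ₗ mulOp (fun p : X × ι => χX k p.1) = Tb k μ ∘ₗ mulOp (fun p : X × ι => χX k p.1))
    (hTfr : ∀ k μ, HasMaj (BlockNorm.ofBlocks g (liftBlk blk ι)) (BlockNorm.ofBlocks g (liftBlk blk ι)) (Tf k μ) (fun y y' => ind (Sk k) y * ind (Sk k) y' * (βQ * Real.exp (-(δ * g.dist y y')))))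
    (hTbr : ∀ k μ, HasMaj (BlockNorm.ofBlocks g (liftBlk blk ι)) (BlockNorm.ofBlocks g (liftBlk blk ι)) (Tb k μ) (fun y y' => ind (Sk k) y * ind (Sk k) y' * (βQ * Real.exp (-(δ * g.dist y y')))))
    (hTfψ : ∀ k μ, Tf k μ ∘ₗ mulOp (fun p : X × ι => ψ₂X k p.1) = Tf k μ) (hTbψ : ∀ k μ, Tb k μ ∘ₗ mulOp (fun p : X × ι => ψ₂X k p.1) = Tb k μ)
    (hflat0 : ∀ k, (mulOp (fun p : X × ι => χtX k p.1) ∘ₗ N k) ∘ₗ (lapOp η⁻¹ (fun μ => liftEquiv (τ μ) ι) 0 + NL) ∘ₗ mulOp (fun p : X × ι => hX k p.1) = mulOp (fun p : X × ι => hX k p.1))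
    -- per cube: the partition (`|h| ≤ 1`, `Σh² = 1`, letters `c₀, c₁, c₂`, block reading `ℓ, ω`), its supports inside `χ_k`, `ψ_k`, `χ̃_k` (with shifts and quotients), transition layers; overlap
    (hhabs : ∀ k x, |hX k x| ≤ 1) (h236 : ∀ p : X × ι, ∑ k, (fun p : X × ι => hX k p.1) p ^ 2 = 1)
    (hhcut : ∀ k, mulOp (fun p : X × ι => hX k p.1) ∘ₗ mulOp (fun p : X × ι => χX k p.1) = mulOp (fun p : X × ι => hX k p.1))
    (hh1 : ∀ k μ x, |fgrad η⁻¹ (τ μ) (hX k) x| ≤ c₁) (hh1b : ∀ k μ x, |bgrad η⁻¹ (τ μ) (hX k) x| ≤ c₁) (hh0 : ∀ k μ x, |hX k (τ μ x) - hX k x| ≤ c₀)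
    (hLip : ∀ k y y', |hb k y - hb k y'| ≤ ℓ * g.dist y y') (hrh : ∀ k x, |hX k x - hb k (blk x)| ≤ ω)
    (hh2 : ∀ k μ p, |fgradAdj η⁻¹ (liftEquiv (τ μ) ι) (fgrad η⁻¹ (liftEquiv (τ μ) ι) (fun p : X × ι => hX k p.1)) p| ≤ c₂)
    (hh2f : ∀ k μ p, |fgrad η⁻¹ (liftEquiv (τ μ) ι) (fgrad η⁻¹ (liftEquiv (τ μ) ι) (fun p : X × ι => hX k p.1)) p| ≤ c₂)
    (hh2b : ∀ k μ p, |bgrad η⁻¹ (liftEquiv (τ μ) ι) (bgrad η⁻¹ (liftEquiv (τ μ) ι) (fun p : X × ι => hX k p.1) ∘ ⇑(liftEquiv (τ μ) ι)) p| ≤ c₂)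
    (hlayf : ∀ k μ x, hX k x ≠ hX k ((τ μ).symm x) → χX k x = 1) (hlayb : ∀ k μ x, hX k (τ μ x) ≠ hX k x → χX k x = 1) (hlayν : ∀ k x, hX k (τ ν x) ≠ 0 → χX k x = 1)
    (hhψ : ∀ k, mulOp (fun p : X × ι => hX k p.1) ∘ₗ mulOp (fun p : X × ι => ψX k p.1) = mulOp (fun p : X × ι => hX k p.1))
    (hχth : ∀ k, mulOp (fun p : X × ι => χtX k p.1) ∘ₗ mulOp (fun p : X × ι => hX k p.1) = mulOp (fun p : X × ι => hX k p.1))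
    (hhts' : ∀ k μ, mulOp (fun p : X × ι => χtX k p.1) ∘ₗ mulOp ((fun p : X × ι => hX k p.1) ∘ (liftEquiv (τ μ) ι)) = mulOp ((fun p : X × ι => hX k p.1) ∘ (liftEquiv (τ μ) ι)))
    (hhtsb' : ∀ k μ, mulOp (fun p : X × ι => χtX k p.1) ∘ₗ mulOp ((fun p : X × ι => hX k p.1) ∘ (liftEquiv (τ μ) ι).symm) = mulOp ((fun p : X × ι => hX k p.1) ∘ (liftEquiv (τ μ) ι).symm))
    (hhtdd' : ∀ k μ, mulOp (fun p : X × ι => χtX k p.1) ∘ₗ mulOp (fgrad η⁻¹ (liftEquiv (τ μ) ι) (fun p : X × ι => hX k p.1)) = mulOp (fgrad η⁻¹ (liftEquiv (τ μ) ι) (fun p : X × ι => hX k p.1)))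
    (hhtddb' : ∀ k μ, mulOp (fun p : X × ι => χtX k p.1) ∘ₗ mulOp (bgrad η⁻¹ (liftEquiv (τ μ) ι) (fun p : X × ι => hX k p.1)) = mulOp (bgrad η⁻¹ (liftEquiv (τ μ) ι) (fun p : X × ι => hX k p.1)))
    (hN : ∀ a, ∑ k, ind (Sk k) a ≤ Nov)
    (hKN : ∀ k, HasMaj (BlockNorm.ofBlocks g (liftBlk blk ι)) (BlockNorm.ofBlocks g (liftBlk blk ι)) (commOp NL (fun p : X × ι => hX k p.1)) (fun y y' => cN * Real.exp (-(ρN * g.dist y y'))))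
    -- THE GAUGE GROUP OF RECORD: trace-form coordinates `e` of `𝔤 = 𝔲(m)`, unitary per-cube site gauges `u_k`, unitary bond variables `U`, Bałaban's nonlocal summand `P` read in cube `k`'s
    -- gauge as `N_L − N_V k`; the species of the transformed bond variables AND THE QUOTIENTS OF ITS FIRST-ORDER PART small where `χ_k ≠ 0` ((3.35) on the cube); letters of `N_V k`
    (he : ∀ A B : Matrix m m ℂ, traceForm A B = e A ⬝ᵥ e B) (hu : ∀ k x, (u k x)ᴴ * u k x = 1) {rV rD RN θF ρF : ℝ} (hrV : 0 ≤ rV) (hrD : 0 ≤ rD) (hRN : 0 ≤ RN) (hθF : 0 ≤ θF)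
    (hρF : ρ₃ ≤ ρF) (hRle : rV * (1 + Fintype.card (J ⊕ J)) + RN ≤ R)
    (hP : ∀ k, mmulOp (fun x => coordMat e (ContinuousLinearMap.mulLeftRight ℝ (Matrix m m ℂ) (u k x) (u k x)ᴴ)) ∘ₗ P ∘ₗ mmulOp (fun x => (coordMat e (ContinuousLinearMap.mulLeftRight ℝ (Matrix m m ℂ) (u k x) (u k x)ᴴ))ᵀ) = NL - NV k)
    (hCloc : ∀ k x, χX k x ≠ 0 → ∀ i, ∑ j, |(tCoefC η (gaugePair τ fun μ x => coordMat e (ContinuousLinearMap.mulLeftRight ℝ (Matrix m m ℂ) (u k x * U μ x * (u k (τ μ x))ᴴ) (u k x * U μ x * (u k (τ μ x))ᴴ)ᴴ))) x i j| ≤ rV)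
    (hAloc : ∀ k j' x, χX k x ≠ 0 → ∀ i, ∑ j, |(tCoefA η (gaugePair τ fun μ x => coordMat e (ContinuousLinearMap.mulLeftRight ℝ (Matrix m m ℂ) (u k x * U μ x * (u k (τ μ x))ᴴ) (u k x * U μ x * (u k (τ μ x))ᴴ)ᴴ))) j' x i j| ≤ rV)
    (hDAf : ∀ k μ x, χX k x ≠ 0 → ∀ i, ∑ j, |fgradMat η⁻¹ (τ μ) ((tCoefA η (gaugePair τ fun μ x => coordMat e (ContinuousLinearMap.mulLeftRight ℝ (Matrix m m ℂ) (u k x * U μ x * (u k (τ μ x))ᴴ) (u k x * U μ x * (u k (τ μ x))ᴴ)ᴴ))) (Sum.inl μ)) x i j| ≤ rD)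
    (hDAb : ∀ k μ x, χX k x ≠ 0 → ∀ i, ∑ j, |fgradMat η⁻¹ (τ μ) ((tCoefA η (gaugePair τ fun μ x => coordMat e (ContinuousLinearMap.mulLeftRight ℝ (Matrix m m ℂ) (u k x * U μ x * (u k (τ μ x))ᴴ) (u k x * U μ x * (u k (τ μ x))ᴴ)ᴴ))) (Sum.inr μ)) x i j| ≤ rD)
    (hNVcut : ∀ k, HasMaj (BlockNorm.ofBlocks g (liftBlk blk ι)) (BlockNorm.ofBlocks g (liftBlk blk ι)) (mulOp (fun p : X × ι => ψX k p.1) ∘ₗ NV k ∘ₗ mulOp (fun p : X × ι => χX k p.1)) (fun y y' => RN * Real.exp (-(δV * g.dist y y'))))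
    (hfarN : ∀ k, HasMaj (BlockNorm.ofBlocks g (liftBlk blk ι)) (BlockNorm.ofBlocks g (liftBlk blk ι)) (mulOp (fun p : X × ι => hX k p.1) ∘ₗ NV k ∘ₗ (LinearMap.id - mulOp (fun p : X × ι => χtX k p.1))) (fun y y' => θF * Real.exp (-(ρF * g.dist y y'))))
    -- THE RIGHT FACTOR `E`: its scalar adjoint Leibniz rule through the partition and its PER-CUBE COVARIANT SHAPE in the gauge `u_k`, with coefficient rows
    {E : (X × ι → ℝ) →ₗ[ℝ] (X × ι → ℝ)} {RE BE : K → X → Matrix ι ι ℝ} {dh : K → X → ℝ} {rR rR' rB : ℝ} (hrR : 0 ≤ rR) (hrR' : 0 ≤ rR') (hrB : 0 ≤ rB)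
    (hleib : ∀ k, mulOp (fun p : X × ι => hX k p.1) ∘ₗ E = E ∘ₗ mulOp (fun p : X × ι => hX k (τ ν p.1)) + mulOp (fun p : X × ι => dh k p.1)) (hdh : ∀ k x, |dh k x| ≤ c₁)
    (hEcov : ∀ k, mmulOp (fun x => coordMat e (ContinuousLinearMap.mulLeftRight ℝ (Matrix m m ℂ) (u k x) (u k x)ᴴ)) ∘ₗ E ∘ₗ mmulOp (fun x => (coordMat e (ContinuousLinearMap.mulLeftRight ℝ (Matrix m m ℂ) (u k x) (u k x)ᴴ))ᵀ) = mmulOp (RE k) ∘ₗ bgrad η⁻¹ (liftEquiv (τ ν) ι) + mmulOp (BE k))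
    (hRE : ∀ k x i, ∑ j, |(RE k ∘ ⇑(τ ν)) x i j| ≤ rR) (hRE' : ∀ k x i, ∑ j, |(fgradMat η⁻¹ (τ ν) (RE k)) x i j| ≤ rR') (hBE : ∀ k x i, ∑ j, |BE k x i j| ≤ rB)
    (hqA : (β * rV + Fintype.card J * (2 * (βQ * rV + β * (rD + ct * rV))) + β * RN * cr) * cr < 1)
    (hqL : Nov * ((Fintype.card ι : ℝ) ^ 2 * ((((((Fintype.card J : ℝ) * (3 * ((β + (β₁ + ct * β)) * (1 - (β + (β₁ + ct * β)) * (R * cr) * cr)⁻¹ * c₂) + 2 * (((1 - (β * rV + Fintype.card J * (2 * (βQ * rV + β * (rD + ct * rV))) + β * RN * cr) * cr)⁻¹ * βQ * cr) * c₁)) + 0)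
          + (β + (β₁ + ct * β)) * (1 - (β + (β₁ + ct * β)) * (R * cr) * cr)⁻¹ * cN * cr)
        + (((Fintype.card J : ℝ) * (2 * rV * (c₁ * ((β + (β₁ + ct * β)) * (1 - (β + (β₁ + ct * β)) * (R * cr) * cr)⁻¹) + c₀ * ((1 - (β * rV + Fintype.card J * (2 * (βQ * rV + β * (rD + ct * rV))) + β * RN * cr) * cr)⁻¹ * βQ * cr))))
          + (β + (β₁ + ct * β)) * (1 - (β + (β₁ + ct * β)) * (R * cr) * cr)⁻¹ * ((ℓ * (Real.exp 1 * ε)⁻¹ + 2 * ω) * RN) * cr))) + (((β + (β₁ + ct * β)) * (1 - (β + (β₁ + ct * β)) * (R * cr) * cr)⁻¹) * θF * cr)) + (Fintype.card ι : ℝ) ^ 2 * 0) * cr < 1)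
    (hq : (β + (β₁ + ct * β)) * (R * cr) * cr < 1) :
    HasMaj (BlockNorm.ofBlocks g (liftBlk blk ι)) (BlockNorm.ofBlocks g (liftBlk blk ι))
      (glueInvL (remainderL (covLapM τ η (gaugePair τ (fun μ x => coordMat e (ContinuousLinearMap.mulLeftRight ℝ (Matrix m m ℂ) (U μ x) (U μ x)ᴴ))) + P) (fun k => fun p : X × ι => hX k p.1) (fun k => (mmulOp (fun x => (coordMat e (ContinuousLinearMap.mulLeftRight ℝ (Matrix m m ℂ) (u k x) (u k x)ᴴ))ᵀ) ∘ₗ (projO none ∘ₗ bgPropV (stack (mulOp (fun p : X × ι => χtX k p.1) ∘ₗ N k) (fun j => Sum.elim (fun μ => fgrad η⁻¹ (liftEquiv (τ μ) ι)) (fun μ => bgrad η⁻¹ (liftEquiv (τ μ) ι)) j ∘ₗ (mulOp (fun p : X × ι => χtX k p.1) ∘ₗ N k))) (unstackM (fun x => χtX k x • (tCoefC η (gaugePair τ fun μ x => coordMat e (ContinuousLinearMap.mulLeftRight ℝ (Matrix m m ℂ) (u k x * U μ x * (u k (τ μ x))ᴴ) (u k x * U μ x * (u k (τ μ x))ᴴ)ᴴ)))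 x) (fun μ x => χtX k x • (tCoefA η (gaugePair τ fun μ x => coordMat e (ContinuousLinearMap.mulLeftRight ℝ (Matrix m m ℂ) (u k x * U μ x * (u k (τ μ x))ᴴ) (u k x * U μ x * (u k (τ μ x))ᴴ)ᴴ))) μ x) + (mulOp (fun p : X × ι => ψX k p.1) ∘ₗ NV k ∘ₗ mulOp (fun p : X × ι => χtX k p.1)) ∘ₗ projO (none : Option (J ⊕ J)))) ∘ₗ mmulOp (fun x => coordMat e (ContinuousLinearMap.mulLeftRight ℝ (Matrix m m ℂ) (u k x) (u k x)ᴴ)))) -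
          ∑ k, mulOp (fun p : X × ι => hX k p.1) ∘ₗ (mmulOp (fun x => (coordMat e (ContinuousLinearMap.mulLeftRight ℝ (Matrix m m ℂ) (u k x) (u k x)ᴴ))ᵀ) ∘ₗ ((projO none ∘ₗ bgPropV (stack (mulOp (fun p : X × ι => χtX k p.1) ∘ₗ N k) (fun j => Sum.elim (fun μ => fgrad η⁻¹ (liftEquiv (τ μ) ι)) (fun μ => bgrad η⁻¹ (liftEquiv (τ μ) ι)) j ∘ₗ (mulOp (fun p : X × ι => χtX k p.1) ∘ₗ N k))) (unstackM (fun x => χtX k x • (tCoefC η (gaugePair τ fun μ x => coordMat e (ContinuousLinearMap.mulLeftRight ℝ (Matrix m m ℂ) (u k x * U μ x * (u k (τ μ x))ᴴ) (u k x * U μ x * (u k (τ μ x))ᴴ)ᴴ))) x) (fun μ x => χtX k x • (tCoefA η (gaugePair τ fun μ x => coordMat e (ContinuousLinearMap.mulLeftRight ℝ (Matrix m m ℂ) (u k x * U μ x * (u k (τ μ x))ᴴ) (u k x * U μ x * (u k (τ μ x))ᴴ)ᴴ))) μ x) + (mulOp (fun p : X × ι => ψX k p.1) ∘ₗ NV k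 ∘ₗ mulOp (fun p : X × ι => χtX k p.1)) ∘ₗ projO (none : Option (J ⊕ J)))) ∘ₗ (-(((unstackM (tCoefC η (gaugePair τ fun μ x => coordMat e (ContinuousLinearMap.mulLeftRight ℝ (Matrix m m ℂ) (u k x * U μ x * (u k (τ μ x))ᴴ) (u k x * U μ x * (u k (τ μ x))ᴴ)ᴴ))) (tCoefA η (gaugePair τ fun μ x => coordMat e (ContinuousLinearMap.mulLeftRight ℝ (Matrix m m ℂ) (u k x * U μ x * (u k (τ μ x))ᴴ) (u k x * U μ x * (u k (τ μ x))ᴴ)ᴴ))) + NV k ∘ₗ projO none) - mulOp (fun p : X × ι => ψX k p.1) ∘ₗ (unstackM (tCoefC η (gaugePair τ fun μ x => coordMat e (ContinuousLinearMap.mulLeftRight ℝ (Matrix m m ℂ) (u k x * U μ x * (u k (τ μ x))ᴴ) (u k x * U μ x * (u k (τ μ x))ᴴ)ᴴ))) (tCoefA η (gaugePair τ fun μ x => coordMat e (ContinuousLinearMap.mulLeftRight ℝ (Matrix m m ℂ) (u k x * U μ x * (u k (τ μ x))ᴴ) (u k x * U μ x * (u k (τ μ x))ᴴ)ᴴ)))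 + NV k ∘ₗ projO none) ∘ₗ mulOp (fun q : (X × ι) × Option (J ⊕ J) => χtX k q.1.1)) ∘ₗ stack LinearMap.id (fun j => Sum.elim (fun μ => fgrad η⁻¹ (liftEquiv (τ μ) ι)) (fun μ => bgrad η⁻¹ (liftEquiv (τ μ) ι)) j))) ∘ₗ mulOp (fun p : X × ι => hX k p.1)) ∘ₗ mmulOp (fun x => coordMat e (ContinuousLinearMap.mulLeftRight ℝ (Matrix m m ℂ) (u k x) (u k x)ᴴ))))
        (parametrix (fun k => fun p : X × ι => hX k p.1) (fun k => (mmulOp (fun x => (coordMat e (ContinuousLinearMap.mulLeftRight ℝ (Matrix m m ℂ) (u k x) (u k x)ᴴ))ᵀ) ∘ₗ (projO none ∘ₗ bgPropV (stack (mulOp (fun p : X × ι => χtX k p.1) ∘ₗ N k) (fun j => Sum.elim (fun μ => fgrad η⁻¹ (liftEquiv (τ μ) ι)) (fun μ => bgrad η⁻¹ (liftEquiv (τ μ) ι)) j ∘ₗ (mulOp (fun p : X × ι => χtX k p.1) ∘ₗ N k))) (unstackM (fun x => χtX k x • (tCoefC η (gaugePair τ fun μ x => coordMat e (ContinuousLinearMap.mulLeftRight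 ℝ (Matrix m m ℂ) (u k x * U μ x * (u k (τ μ x))ᴴ) (u k x * U μ x * (u k (τ μ x))ᴴ)ᴴ))) x) (fun μ x => χtX k x • (tCoefA η (gaugePair τ fun μ x => coordMat e (ContinuousLinearMap.mulLeftRight ℝ (Matrix m m ℂ) (u k x * U μ x * (u k (τ μ x))ᴴ) (u k x * U μ x * (u k (τ μ x))ᴴ)ᴴ))) μ x) + (mulOp (fun p : X × ι => ψX k p.1) ∘ₗ NV k ∘ₗ mulOp (fun p : X × ι => χtX k p.1)) ∘ₗ projO (none : Option (J ⊕ J)))) ∘ₗ mmulOp (fun x => coordMat e (ContinuousLinearMap.mulLeftRight ℝ (Matrix m m ℂ) (u k x) (u k x)ᴴ))))) ∘ₗ E)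
      (fun y y' => (1 - Nov * ((Fintype.card ι : ℝ) ^ 2 * ((((((Fintype.card J : ℝ) * (3 * ((β + (β₁ + ct * β)) * (1 - (β + (β₁ + ct * β)) * (R * cr) * cr)⁻¹ * c₂) + 2 * (((1 - (β * rV + Fintype.card J * (2 * (βQ * rV + β * (rD + ct * rV))) + β * RN * cr) * cr)⁻¹ * βQ * cr) * c₁)) + 0)
          + (β + (β₁ + ct * β)) * (1 - (β + (β₁ + ct * β)) * (R * cr) * cr)⁻¹ * cN * cr)
        + (((Fintype.card J : ℝ) * (2 * rV * (c₁ * ((β + (β₁ + ct * β)) * (1 - (β + (β₁ + ct * β)) * (R * cr) * cr)⁻¹) + c₀ * ((1 - (β * rV + Fintype.card J * (2 * (βQ * rV + β * (rD + ct * rV))) + β * RN * cr) * cr)⁻¹ * βQ * cr))))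
          + (β + (β₁ + ct * β)) * (1 - (β + (β₁ + ct * β)) * (R * cr) * cr)⁻¹ * ((ℓ * (Real.exp 1 * ε)⁻¹ + 2 * ω) * RN) * cr))) + (((β + (β₁ + ct * β)) * (1 - (β + (β₁ + ct * β)) * (R * cr) * cr)⁻¹) * θF * cr)) + (Fintype.card ι : ℝ) ^ 2 * 0) * cr)⁻¹ * (Nov * ((Fintype.card ι : ℝ) ^ 2 * (((1 - (β * rV + Fintype.card J * (2 * (βQ * rV + β * (rD + ct * rV))) + β * RN * cr) * cr)⁻¹ * βQ * cr) * rR + ((β + (β₁ + ct * β)) * (1 - (β + (β₁ + ct * β)) * (R * cr) * cr)⁻¹) * rR' + ((β + (β₁ + ct * β)) * (1 - (β + (β₁ + ct * β)) * (R * cr) * cr)⁻¹) * rB) * 1 + (Fintype.card ι : ℝ) ^ 2 * ((β + (β₁ + ct * β)) * (1 - (β + (β₁ + ct * β)) * (R * cr) * cr)⁻¹) * c₁)) * cr *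
        Real.exp (-((ρ₃ - 2 * σ) * g.dist y y'))) ∧
    (glueInvL (remainderL (covLapM τ η (gaugePair τ (fun μ x => coordMat e (ContinuousLinearMap.mulLeftRight ℝ (Matrix m m ℂ) (U μ x) (U μ x)ᴴ))) + P) (fun k => fun p : X × ι => hX k p.1) (fun k => (mmulOp (fun x => (coordMat e (ContinuousLinearMap.mulLeftRight ℝ (Matrix m m ℂ) (u k x) (u k x)ᴴ))ᵀ) ∘ₗ (projO none ∘ₗ bgPropV (stack (mulOp (fun p : X × ι => χtX k p.1) ∘ₗ N k) (fun j => Sum.elim (fun μ => fgrad η⁻¹ (liftEquiv (τ μ) ι)) (fun μ => bgrad η⁻¹ (liftEquiv (τ μ) ι)) j ∘ₗ (mulOp (fun p : X × ι => χtX k p.1) ∘ₗ N k))) (unstackM (fun x => χtX k x • (tCoefC η (gaugePair τ fun μ x => coordMat e (ContinuousLinearMap.mulLeftRight ℝ (Matrix m m ℂ) (u k x * U μ x * (u k (τ μ x))ᴴ) (u k x * U μ x * (u k (τ μ x))ᴴ)ᴴ))) x) (fun μ x => χtX k x • (tCoefA η (gaugePair τ fun μ x => coordMat e (ContinuousLinearMap.mulLeftRight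 ℝ (Matrix m m ℂ) (u k x * U μ x * (u k (τ μ x))ᴴ) (u k x * U μ x * (u k (τ μ x))ᴴ)ᴴ))) μ x) + (mulOp (fun p : X × ι => ψX k p.1) ∘ₗ NV k ∘ₗ mulOp (fun p : X × ι => χtX k p.1)) ∘ₗ projO (none : Option (J ⊕ J)))) ∘ₗ mmulOp (fun x => coordMat e (ContinuousLinearMap.mulLeftRight ℝ (Matrix m m ℂ) (u k x) (u k x)ᴴ)))) -
          ∑ k, mulOp (fun p : X × ι => hX k p.1) ∘ₗ (mmulOp (fun x => (coordMat e (ContinuousLinearMap.mulLeftRight ℝ (Matrix m m ℂ) (u k x) (u k x)ᴴ))ᵀ) ∘ₗ ((projO none ∘ₗ bgPropV (stack (mulOp (fun p : X × ι => χtX k p.1) ∘ₗ N k) (fun j => Sum.elim (fun μ => fgrad η⁻¹ (liftEquiv (τ μ) ι)) (fun μ => bgrad η⁻¹ (liftEquiv (τ μ) ι)) j ∘ₗ (mulOp (fun p : X × ι => χtX k p.1) ∘ₗ N k))) (unstackM (fun x => χtX k x • (tCoefC η (gaugePair τ fun μ x => coordMat e (ContinuousLinearMap.mulLeftRight ℝ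 (Matrix m m ℂ) (u k x * U μ x * (u k (τ μ x))ᴴ) (u k x * U μ x * (u k (τ μ x))ᴴ)ᴴ))) x) (fun μ x => χtX k x • (tCoefA η (gaugePair τ fun μ x => coordMat e (ContinuousLinearMap.mulLeftRight ℝ (Matrix m m ℂ) (u k x * U μ x * (u k (τ μ x))ᴴ) (u k x * U μ x * (u k (τ μ x))ᴴ)ᴴ))) μ x) + (mulOp (fun p : X × ι => ψX k p.1) ∘ₗ NV k ∘ₗ mulOp (fun p : X × ι => χtX k p.1)) ∘ₗ projO (none : Option (J ⊕ J)))) ∘ₗ (-(((unstackM (tCoefC η (gaugePair τ fun μ x => coordMat e (ContinuousLinearMap.mulLeftRight ℝ (Matrix m m ℂ) (u k x * U μ x * (u k (τ μ x))ᴴ) (u k x * U μ x * (u k (τ μ x))ᴴ)ᴴ))) (tCoefA η (gaugePair τ fun μ x => coordMat e (ContinuousLinearMap.mulLeftRight ℝ (Matrix m m ℂ) (u k x * U μ x * (u k (τ μ x))ᴴ) (u k x * U μ x * (u k (τ μ x))ᴴ)ᴴ))) + NV k ∘ₗ projO none) - mulOp (fun p : X × ι => ψX k p.1) ∘ₗ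 (unstackM (tCoefC η (gaugePair τ fun μ x => coordMat e (ContinuousLinearMap.mulLeftRight ℝ (Matrix m m ℂ) (u k x * U μ x * (u k (τ μ x))ᴴ) (u k x * U μ x * (u k (τ μ x))ᴴ)ᴴ))) (tCoefA η (gaugePair τ fun μ x => coordMat e (ContinuousLinearMap.mulLeftRight ℝ (Matrix m m ℂ) (u k x * U μ x * (u k (τ μ x))ᴴ) (u k x * U μ x * (u k (τ μ x))ᴴ)ᴴ))) + NV k ∘ₗ projO none) ∘ₗ mulOp (fun q : (X × ι) × Option (J ⊕ J) => χtX k q.1.1)) ∘ₗ stack LinearMap.id (fun j => Sum.elim (fun μ => fgrad η⁻¹ (liftEquiv (τ μ) ι)) (fun μ => bgrad η⁻¹ (liftEquiv (τ μ) ι)) j))) ∘ₗ mulOp (fun p : X × ι => hX k p.1)) ∘ₗ mmulOp (fun x => coordMat e (ContinuousLinearMap.mulLeftRight ℝ (Matrix m m ℂ) (u k x) (u k x)ᴴ))))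
        (parametrix (fun k => fun p : X × ι => hX k p.1) (fun k => (mmulOp (fun x => (coordMat e (ContinuousLinearMap.mulLeftRight ℝ (Matrix m m ℂ) (u k x) (u k x)ᴴ))ᵀ) ∘ₗ (projO none ∘ₗ bgPropV (stack (mulOp (fun p : X × ι => χtX k p.1) ∘ₗ N k) (fun j => Sum.elim (fun μ => fgrad η⁻¹ (liftEquiv (τ μ) ι)) (fun μ => bgrad η⁻¹ (liftEquiv (τ μ) ι)) j ∘ₗ (mulOp (fun p : X × ι => χtX k p.1) ∘ₗ N k))) (unstackM (fun x => χtX k x • (tCoefC η (gaugePair τ fun μ x => coordMat e (ContinuousLinearMap.mulLeftRight ℝ (Matrix m m ℂ) (u k x * U μ x * (u k (τ μ x))ᴴ) (u k x * U μ x * (u k (τ μ x))ᴴ)ᴴ))) x) (fun μ x => χtX k x • (tCoefA η (gaugePair τ fun μ x => coordMat e (ContinuousLinearMap.mulLeftRight ℝ (Matrix m m ℂ) (u k x * U μ x * (u k (τ μ x))ᴴ) (u k x * U μ x * (u k (τ μ x))ᴴ)ᴴ))) μ x) + (mulOp (fun p : X × ι => ψX k p.1) ∘ₗ NV k ∘ₗ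 mulOp (fun p : X × ι => χtX k p.1)) ∘ₗ projO (none : Option (J ⊕ J)))) ∘ₗ mmulOp (fun x => coordMat e (ContinuousLinearMap.mulLeftRight ℝ (Matrix m m ℂ) (u k x) (u k x)ᴴ))))) ∘ₗ (covLapM τ η (gaugePair τ (fun μ x => coordMat e (ContinuousLinearMap.mulLeftRight ℝ (Matrix m m ℂ) (U μ x) (U μ x)ᴴ))) + P) = LinearMap.id ∧
      (covLapM τ η (gaugePair τ (fun μ x => coordMat e (ContinuousLinearMap.mulLeftRight ℝ (Matrix m m ℂ) (U μ x) (U μ x)ᴴ))) + P) ∘ₗ glueInvL (remainderL (covLapM τ η (gaugePair τ (fun μ x => coordMat e (ContinuousLinearMap.mulLeftRight ℝ (Matrix m m ℂ) (U μ x) (U μ x)ᴴ))) + P) (fun k => fun p : X × ι => hX k p.1) (fun k => (mmulOp (fun x => (coordMat e (ContinuousLinearMap.mulLeftRight ℝ (Matrix m m ℂ) (u k x) (u k x)ᴴ))ᵀ) ∘ₗ (projO none ∘ₗ bgPropV (stack (mulOp (fun p : X × ι => χtX k p.1) ∘ₗ N k) (fun j => Sum.elim (fun μ => fgrad η⁻¹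 (liftEquiv (τ μ) ι)) (fun μ => bgrad η⁻¹ (liftEquiv (τ μ) ι)) j ∘ₗ (mulOp (fun p : X × ι => χtX k p.1) ∘ₗ N k))) (unstackM (fun x => χtX k x • (tCoefC η (gaugePair τ fun μ x => coordMat e (ContinuousLinearMap.mulLeftRight ℝ (Matrix m m ℂ) (u k x * U μ x * (u k (τ μ x))ᴴ) (u k x * U μ x * (u k (τ μ x))ᴴ)ᴴ))) x) (fun μ x => χtX k x • (tCoefA η (gaugePair τ fun μ x => coordMat e (ContinuousLinearMap.mulLeftRight ℝ (Matrix m m ℂ) (u k x * U μ x * (u k (τ μ x))ᴴ) (u k x * U μ x * (u k (τ μ x))ᴴ)ᴴ))) μ x) + (mulOp (fun p : X × ι => ψX k p.1) ∘ₗ NV k ∘ₗ mulOp (fun p : X × ι => χtX k p.1)) ∘ₗ projO (none : Option (J ⊕ J)))) ∘ₗ mmulOp (fun x => coordMat e (ContinuousLinearMap.mulLeftRight ℝ (Matrix m m ℂ) (u k x) (u k x)ᴴ)))) -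
          ∑ k, mulOp (fun p : X × ι => hX k p.1) ∘ₗ (mmulOp (fun x => (coordMat e (ContinuousLinearMap.mulLeftRight ℝ (Matrix m m ℂ) (u k x) (u k x)ᴴ))ᵀ) ∘ₗ ((projO none ∘ₗ bgPropV (stack (mulOp (fun p : X × ι => χtX k p.1) ∘ₗ N k) (fun j => Sum.elim (fun μ => fgrad η⁻¹ (liftEquiv (τ μ) ι)) (fun μ => bgrad η⁻¹ (liftEquiv (τ μ) ι)) j ∘ₗ (mulOp (fun p : X × ι => χtX k p.1) ∘ₗ N k))) (unstackM (fun x => χtX k x • (tCoefC η (gaugePair τ fun μ x => coordMat e (ContinuousLinearMap.mulLeftRight ℝ (Matrix m m ℂ) (u k x * U μ x * (u k (τ μ x))ᴴ) (u k x * U μ x * (u k (τ μ x))ᴴ)ᴴ))) x) (fun μ x => χtX k x • (tCoefA η (gaugePair τ fun μ x => coordMat e (ContinuousLinearMap.mulLeftRight ℝ (Matrix m m ℂ) (u k x * U μ x * (u k (τ μ x))ᴴ) (u k x * U μ x * (u k (τ μ x))ᴴ)ᴴ))) μ x) + (mulOp (fun p : X × ι => ψX k p.1) ∘ₗ NV k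 ∘ₗ mulOp (fun p : X × ι => χtX k p.1)) ∘ₗ projO (none : Option (J ⊕ J)))) ∘ₗ (-(((unstackM (tCoefC η (gaugePair τ fun μ x => coordMat e (ContinuousLinearMap.mulLeftRight ℝ (Matrix m m ℂ) (u k x * U μ x * (u k (τ μ x))ᴴ) (u k x * U μ x * (u k (τ μ x))ᴴ)ᴴ))) (tCoefA η (gaugePair τ fun μ x => coordMat e (ContinuousLinearMap.mulLeftRight ℝ (Matrix m m ℂ) (u k x * U μ x * (u k (τ μ x))ᴴ) (u k x * U μ x * (u k (τ μ x))ᴴ)ᴴ))) + NV k ∘ₗ projO none) - mulOp (fun p : X × ι => ψX k p.1) ∘ₗ (unstackM (tCoefC η (gaugePair τ fun μ x => coordMat e (ContinuousLinearMap.mulLeftRight ℝ (Matrix m m ℂ) (u k x * U μ x * (u k (τ μ x))ᴴ) (u k x * U μ x * (u k (τ μ x))ᴴ)ᴴ))) (tCoefA η (gaugePair τ fun μ x => coordMat e (ContinuousLinearMap.mulLeftRight ℝ (Matrix m m ℂ) (u k x * U μ x * (u k (τ μ x))ᴴ) (u k x * U μ x * (u k (τ μ x))ᴴ)ᴴ)))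 + NV k ∘ₗ projO none) ∘ₗ mulOp (fun q : (X × ι) × Option (J ⊕ J) => χtX k q.1.1)) ∘ₗ stack LinearMap.id (fun j => Sum.elim (fun μ => fgrad η⁻¹ (liftEquiv (τ μ) ι)) (fun μ => bgrad η⁻¹ (liftEquiv (τ μ) ι)) j))) ∘ₗ mulOp (fun p : X × ι => hX k p.1)) ∘ₗ mmulOp (fun x => coordMat e (ContinuousLinearMap.mulLeftRight ℝ (Matrix m m ℂ) (u k x) (u k x)ᴴ))))
        (parametrix (fun k => fun p : X × ι => hX k p.1) (fun k => (mmulOp (fun x => (coordMat e (ContinuousLinearMap.mulLeftRight ℝ (Matrix m m ℂ) (u k x) (u k x)ᴴ))ᵀ) ∘ₗ (projO none ∘ₗ bgPropV (stack (mulOp (fun p : X × ι => χtX k p.1) ∘ₗ N k) (fun j => Sum.elim (fun μ => fgrad η⁻¹ (liftEquiv (τ μ) ι)) (fun μ => bgrad η⁻¹ (liftEquiv (τ μ) ι)) j ∘ₗ (mulOp (fun p : X × ι => χtX k p.1) ∘ₗ N k))) (unstackM (fun x => χtX k x • (tCoefC η (gaugePair τ fun μ x => coordMat e (ContinuousLinearMap.mulLeftRight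 ℝ (Matrix m m ℂ) (u k x * U μ x * (u k (τ μ x))ᴴ) (u k x * U μ x * (u k (τ μ x))ᴴ)ᴴ))) x) (fun μ x => χtX k x • (tCoefA η (gaugePair τ fun μ x => coordMat e (ContinuousLinearMap.mulLeftRight ℝ (Matrix m m ℂ) (u k x * U μ x * (u k (τ μ x))ᴴ) (u k x * U μ x * (u k (τ μ x))ᴴ)ᴴ))) μ x) + (mulOp (fun p : X × ι => ψX k p.1) ∘ₗ NV k ∘ₗ mulOp (fun p : X × ι => χtX k p.1)) ∘ₗ projO (none : Option (J ⊕ J)))) ∘ₗ mmulOp (fun x => coordMat e (ContinuousLinearMap.mulLeftRight ℝ (Matrix m m ℂ) (u k x) (u k x)ᴴ))))) = LinearMap.id) := by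
  have hβb : 0 ≤ β + (β₁ + ct * β) := by positivity
  have hqi : 0 ≤ (1 - (β + (β₁ + ct * β)) * (R * cr) * cr)⁻¹ := inv_nonneg.2 (by linarith)
  have hB : 0 ≤ ((β + (β₁ + ct * β)) * (1 - (β + (β₁ + ct * β)) * (R * cr) * cr)⁻¹) := mul_nonneg hβb hqi
  have rate₁ : ∀ (T : Set g.Site) {c : ℝ}, 0 ≤ c → ∀ y y' : g.Site,
      ind T y * ind T y' * (c * Real.exp (-(δ * g.dist y y'))) ≤ ind T y * ind T y' * (c * Real.exp (-(ρ₁ * g.dist y y'))) :=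
    fun T c hc y y' => mul_le_mul_of_nonneg_left (exp_rate_mono hd hc (by linarith : ρ₁ ≤ δ) y y') (mul_nonneg (ind_nonneg _ _) (ind_nonneg _ _))
  have hTfr₁ := fun k μ => (hTfr k μ).mono (rate₁ (Sk k) hβQ)
  have hTbr₁ := fun k μ => (hTbr k μ).mono (rate₁ (Sk k) hβQ)
  have hug : ∀ k x, (fun x => coordMat e (ContinuousLinearMap.mulLeftRight ℝ (Matrix m m ℂ) (u k x) (u k x)ᴴ)) x * ((fun x => coordMat e (ContinuousLinearMap.mulLeftRight ℝ (Matrix m m ℂ) (u k x) (u k x)ᴴ)) x)ᵀ = 1 := fun k x => (uN_siteGauge_orthogonal e (u k) he (hu k) x).1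
  have hug' : ∀ k x, ((fun x => coordMat e (ContinuousLinearMap.mulLeftRight ℝ (Matrix m m ℂ) (u k x) (u k x)ᴴ)) x)ᵀ * (fun x => coordMat e (ContinuousLinearMap.mulLeftRight ℝ (Matrix m m ℂ) (u k x) (u k x)ᴴ)) x = 1 := fun k x => (uN_siteGauge_orthogonal e (u k) he (hu k) x).2
  -- pointwise consequences of the insertions: `supp χ̃_k ⊆ {χ_k = 1}` (also shifted), `M_ψM_χ̃ = M_χ̃`
  have hone : ∀ {a b : X → ℝ}, mulOp (fun p : X × ι => a p.1) ∘ₗ mulOp (fun p : X × ι => b p.1) = mulOp (fun p : X × ι => a p.1) → ∀ (x : X) (i : ι), a x ≠ 0 → b x = 1 := by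
    intro a b hab x i hx
    have h2 := congrFun (LinearMap.congr_fun hab (fun _ => (1 : ℝ))) (x, i)
    simp only [LinearMap.comp_apply, mulOp_apply, mul_one] at h2
    exact mul_left_cancel₀ hx (by rw [h2, mul_one])
  have hχtχ : ∀ k x (i : ι), χtX k x ≠ 0 → χX k x ≠ 0 := fun k x i hx => by rw [hone (hsub k) x i hx]; exact one_ne_zero
  have hχts : ∀ k μ x (i : ι), χtX k (τ μ x) ≠ 0 → χX k x ≠ 0 := fun k μ x i hx => by
    have h2 := congrFun (LinearMap.congr_fun (hs k μ) (fun _ => (1 : ℝ))) (x, i)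
    simp only [LinearMap.comp_apply, mulOp_apply, mul_one, Function.comp_apply, liftEquiv_apply] at h2
    have h1 : χX k x = 1 := mul_left_cancel₀ hx (by rw [h2, mul_one])
    rw [h1]; exact one_ne_zero
  have hψχt : ∀ k, mulOp (fun p : X × ι => ψX k p.1) ∘ₗ mulOp (fun p : X × ι => χtX k p.1) = mulOp (fun p : X × ι => χtX k p.1) := fun k => by
    rw [← hsub k, ← LinearMap.comp_assoc, mulOp_comp_mulOp_comm (fun p : X × ι => ψX k p.1), LinearMap.comp_assoc, hψχ k]
  -- the smooth-cut coefficients' letters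
  have hCk : ∀ k x i, ∑ j, |(fun x => χtX k x • (tCoefC η (gaugePair τ fun μ x => coordMat e (ContinuousLinearMap.mulLeftRight ℝ (Matrix m m ℂ) (u k x * U μ x * (u k (τ μ x))ᴴ) (u k x * U μ x * (u k (τ μ x))ᴴ)ᴴ))) x) x i j| ≤ rV := fun k x i => rowSum_smul_le_of_local hrV (hχt k) (fun x hx => hCloc k x (hχtχ k x i hx)) x i
  have hAk : ∀ k j' x i, ∑ j, |(fun μ x => χtX k x • (tCoefA η (gaugePair τ fun μ x => coordMat e (ContinuousLinearMap.mulLeftRight ℝ (Matrix m m ℂ) (u k x * U μ x * (u k (τ μ x))ᴴ) (u k x * U μ x * (u k (τ μ x))ᴴ)ᴴ))) μ x) j' x i j| ≤ rV := fun k j' x i => rowSum_smul_le_of_local hrV (hχt k) (fun x hx => hAloc k j' x (hχtχ k x i hx)) x i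
  have hgrad : ∀ k μ (A0 : X → Matrix ι ι ℝ), (∀ x, χX k x ≠ 0 → ∀ i, ∑ j, |A0 x i j| ≤ rV) → (∀ x, χX k x ≠ 0 → ∀ i, ∑ j, |fgradMat η⁻¹ (τ μ) A0 x i j| ≤ rD) →
      ∀ x i, ∑ j, |fgradMat η⁻¹ (τ μ) (fun x => χtX k x • A0 x) x i j| ≤ rD + ct * rV := by
    intro k μ A0 hA0 hDA0 x i
    have hsplit : ∀ j, fgradMat η⁻¹ (τ μ) (fun x => χtX k x • A0 x) x i j = χtX k (τ μ x) * fgradMat η⁻¹ (τ μ) A0 x i j + (η⁻¹ * (χtX k (τ μ x) - χtX k x)) * A0 x i j := by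
      intro j; simp only [fgradMat, Matrix.smul_apply, Matrix.sub_apply, smul_eq_mul]; ring
    have hct' : |η⁻¹ * (χtX k (τ μ x) - χtX k x)| ≤ ct := by
      have h := hdχt k μ (x, i); rwa [fgrad_apply, liftEquiv_apply] at h
    have h1 : ∑ j, |χtX k (τ μ x) * fgradMat η⁻¹ (τ μ) A0 x i j| ≤ rD := by
      by_cases hx : χtX k (τ μ x) = 0
      · simp [hx, hrD]
      · calc ∑ j, |χtX k (τ μ x) * fgradMat η⁻¹ (τ μ) A0 x i j| = |χtX k (τ μ x)| * ∑ j, |fgradMat η⁻¹ (τ μ) A0 x i j| := by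
              rw [Finset.mul_sum]; exact Finset.sum_congr rfl fun j _ => abs_mul _ _
          _ ≤ 1 * rD := mul_le_mul (hχt k _) (hDA0 x (hχts k μ x i hx) i) (Finset.sum_nonneg fun _ _ => abs_nonneg _) zero_le_one
          _ = rD := one_mul _
    have h2 : ∑ j, |(η⁻¹ * (χtX k (τ μ x) - χtX k x)) * A0 x i j| ≤ ct * rV := by
      by_cases hx : η⁻¹ * (χtX k (τ μ x) - χtX k x) = 0
      · simp [hx]; positivity
      · have hxx : χX k x ≠ 0 := by
          by_cases h0 : χtX k x = 0
          · have h3 : χtX k (τ μ x) ≠ 0 := by intro h3; apply hx; rw [h3, h0, sub_zero, mul_zero]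
            exact hχts k μ x i h3
          · exact hχtχ k x i h0
        calc ∑ j, |(η⁻¹ * (χtX k (τ μ x) - χtX k x)) * A0 x i j| = |η⁻¹ * (χtX k (τ μ x) - χtX k x)| * ∑ j, |A0 x i j| := by
              rw [Finset.mul_sum]; exact Finset.sum_congr rfl fun j _ => abs_mul _ _
          _ ≤ ct * rV := mul_le_mul hct' (hA0 x hxx i) (Finset.sum_nonneg fun _ _ => abs_nonneg _) hct
    calc ∑ j, |fgradMat η⁻¹ (τ μ) (fun x => χtX k x • A0 x) x i j|
        = ∑ j, |χtX k (τ μ x) * fgradMat η⁻¹ (τ μ) A0 x i j + (η⁻¹ * (χtX k (τ μ x) - χtX k x)) * A0 x i j| := Finset.sum_congr rfl fun j _ => by rw [hsplit j]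
      _ ≤ ∑ j, (|χtX k (τ μ x) * fgradMat η⁻¹ (τ μ) A0 x i j| + |(η⁻¹ * (χtX k (τ μ x) - χtX k x)) * A0 x i j|) := Finset.sum_le_sum fun j _ => abs_add_le _ _
      _ ≤ rD + ct * rV := by rw [Finset.sum_add_distrib]; exact add_le_add h1 h2
  have hgAf : ∀ k μ x i, ∑ j, |fgradMat η⁻¹ (τ μ) ((fun μ x => χtX k x • (tCoefA η (gaugePair τ fun μ x => coordMat e (ContinuousLinearMap.mulLeftRight ℝ (Matrix m m ℂ) (u k x * U μ x * (u k (τ μ x))ᴴ) (u k x * U μ x * (u k (τ μ x))ᴴ)ᴴ))) μ x) (Sum.inl μ)) x i j| ≤ rD + ct * rV := fun k μ => hgrad k μ _ (fun x hx => hAloc k (Sum.inl μ) x hx) (hDAf k μ)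
  have hgAb : ∀ k μ x i, ∑ j, |fgradMat η⁻¹ (τ μ) ((fun μ x => χtX k x • (tCoefA η (gaugePair τ fun μ x => coordMat e (ContinuousLinearMap.mulLeftRight ℝ (Matrix m m ℂ) (u k x * U μ x * (u k (τ μ x))ᴴ) (u k x * U μ x * (u k (τ μ x))ᴴ)ᴴ))) μ x) (Sum.inr μ)) x i j| ≤ rD + ct * rV := fun k μ => hgrad k μ _ (fun x hx => hAloc k (Sum.inr μ) x hx) (hDAb k μ)
  -- the cut nonlocal perturbation `M_ψN_VM_χ̃ = (M_ψN_VM_χ)M_χ̃` and its row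
  have hNVk : ∀ k, HasMaj (BlockNorm.ofBlocks g (liftBlk blk ι)) (BlockNorm.ofBlocks g (liftBlk blk ι)) (mulOp (fun p : X × ι => ψX k p.1) ∘ₗ NV k ∘ₗ mulOp (fun p : X × ι => χtX k p.1)) (fun y y' => RN * Real.exp (-(δV * g.dist y y'))) := fun k => by
    have h1 : (mulOp (fun p : X × ι => ψX k p.1) ∘ₗ NV k ∘ₗ mulOp (fun p : X × ι => χtX k p.1)) = (mulOp (fun p : X × ι => ψX k p.1) ∘ₗ NV k ∘ₗ mulOp (fun p : X × ι => χX k p.1)) ∘ₗ mulOp (fun p : X × ι => χtX k p.1) := by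
      simp only [LinearMap.comp_assoc]; rw [hχ k]
    rw [h1]
    refine (hasMaj_comp_diag (liftBlk blk ι) (fun y y' => mul_nonneg hRN (Real.exp_nonneg _)) (hNVcut k)
      (hasMaj_mulOp (g := g) (liftBlk blk ι) (m := fun _ => (1 : ℝ)) (fun _ => zero_le_one) (fun p : X × ι => hχt k p.1))).mono fun y y' => le_of_eq (mul_one _)
  -- the cube perturbation in `unstackM` form, its letter
  have hVeq : ∀ k, mulOp (fun p : X × ι => ψX k p.1) ∘ₗ (unstackM (tCoefC η (gaugePair τ fun μ x => coordMat e (ContinuousLinearMap.mulLeftRight ℝ (Matrix m m ℂ) (u k x * U μ x * (u k (τ μ x))ᴴ) (u k x * U μ x * (u k (τ μ x))ᴴ)ᴴ))) (tCoefA η (gaugePair τ fun μ x => coordMat e (ContinuousLinearMap.mulLeftRight ℝ (Matrix m m ℂ) (u k x * U μ x * (u k (τ μ x))ᴴ) (u k x * U μ x * (u k (τ μ x))ᴴ)ᴴ))) + NV k ∘ₗ projO none) ∘ₗ mulOp (fun q : (X × ι) × Option (J ⊕ J) => χtX k q.1.1) = (unstackM (fun x => χtX k x • (tCoefC η (gaugePair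 τ fun μ x => coordMat e (ContinuousLinearMap.mulLeftRight ℝ (Matrix m m ℂ) (u k x * U μ x * (u k (τ μ x))ᴴ) (u k x * U μ x * (u k (τ μ x))ᴴ)ᴴ))) x) (fun μ x => χtX k x • (tCoefA η (gaugePair τ fun μ x => coordMat e (ContinuousLinearMap.mulLeftRight ℝ (Matrix m m ℂ) (u k x * U μ x * (u k (τ μ x))ᴴ) (u k x * U μ x * (u k (τ μ x))ᴴ)ᴴ))) μ x) + (mulOp (fun p : X × ι => ψX k p.1) ∘ₗ NV k ∘ₗ mulOp (fun p : X × ι => χtX k p.1)) ∘ₗ projO (none : Option (J ⊕ J))) := fun k => cutPert_structural_eq (tCoefC η (gaugePair τ fun μ x => coordMat e (ContinuousLinearMap.mulLeftRight ℝ (Matrix m m ℂ) (u k x * U μ x * (u k (τ μ x))ᴴ) (u k x * U μ x * (u k (τ μ x))ᴴ)ᴴ))) (tCoefA η (gaugePair τ fun μ x => coordMat e (ContinuousLinearMap.mulLeftRight ℝ (Matrix m m ℂ) (u k x * U μ x * (u k (τ μ x))ᴴ) (u k x * U μ x * (u k (τ μ x))ᴴ)ᴴ))) (NV k) (hψχt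 k)
  have hV : ∀ k, HasMaj (BlockNorm.ofBlocks g (blkPair (liftBlk blk ι))) (BlockNorm.ofBlocks g (liftBlk blk ι)) (unstackM (fun x => χtX k x • (tCoefC η (gaugePair τ fun μ x => coordMat e (ContinuousLinearMap.mulLeftRight ℝ (Matrix m m ℂ) (u k x * U μ x * (u k (τ μ x))ᴴ) (u k x * U μ x * (u k (τ μ x))ᴴ)ᴴ))) x) (fun μ x => χtX k x • (tCoefA η (gaugePair τ fun μ x => coordMat e (ContinuousLinearMap.mulLeftRight ℝ (Matrix m m ℂ) (u k x * U μ x * (u k (τ μ x))ᴴ) (u k x * U μ x * (u k (τ μ x))ᴴ)ᴴ))) μ x) + (mulOp (fun p : X × ι => ψX k p.1) ∘ₗ NV k ∘ₗ mulOp (fun p : X × ι => χtX k p.1)) ∘ₗ projO (none : Option (J ⊕ J))) (fun y y' => R * Real.exp (-(δV * g.dist y y'))) := fun k => by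
    rw [← hVeq k]
    exact (hasMaj_cutPert_structural_of_local blk hd0 hrV hRN (hχt k) (fun x hx i => hCloc k x (hχtχ k x i hx) i) (fun μ x hx i => hAloc k μ x (hχtχ k x i hx) i) (hψχt k) (hNVk k)).mono
      fun y y' => mul_le_mul_of_nonneg_right hRle (Real.exp_nonneg _)
  -- THE COVARIANCE IDENTITY: the global operator read in cube `k` = the cube's model + the far defect of the smooth jet cut
  have hcov : ∀ k, mmulOp (fun x => coordMat e (ContinuousLinearMap.mulLeftRight ℝ (Matrix m m ℂ) (u k x) (u k x)ᴴ)) ∘ₗ (covLapM τ η (gaugePair τ (fun μ x => coordMat e (ContinuousLinearMap.mulLeftRight ℝ (Matrix m m ℂ) (U μ x) (U μ x)ᴴ))) + P) ∘ₗ mmulOp (fun x => (coordMat e (ContinuousLinearMap.mulLeftRight ℝ (Matrix m m ℂ) (u k x) (u k x)ᴴ))ᵀ) = (lapOp η⁻¹ (fun μ => liftEquiv (τ μ) ι) 0 + NL - (unstackM (fun x => χtX k x • (tCoefC η (gaugePair τ fun μ x => coordMat e (ContinuousLinearMap.mulLeftRight ℝ (Matrix m m ℂ) (u k x * U μ x *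 (u k (τ μ x))ᴴ) (u k x * U μ x * (u k (τ μ x))ᴴ)ᴴ))) x) (fun μ x => χtX k x • (tCoefA η (gaugePair τ fun μ x => coordMat e (ContinuousLinearMap.mulLeftRight ℝ (Matrix m m ℂ) (u k x * U μ x * (u k (τ μ x))ᴴ) (u k x * U μ x * (u k (τ μ x))ᴴ)ᴴ))) μ x) + (mulOp (fun p : X × ι => ψX k p.1) ∘ₗ NV k ∘ₗ mulOp (fun p : X × ι => χtX k p.1)) ∘ₗ projO (none : Option (J ⊕ J))) ∘ₗ stack LinearMap.id (fun j => Sum.elim (fun μ => fgrad η⁻¹ (liftEquiv (τ μ) ι)) (fun μ => bgrad η⁻¹ (liftEquiv (τ μ) ι)) j)) + (-(((unstackM (tCoefC η (gaugePair τ fun μ x => coordMat e (ContinuousLinearMap.mulLeftRight ℝ (Matrix m m ℂ) (u k x * U μ x * (u k (τ μ x))ᴴ) (u k x * U μ x * (u k (τ μ x))ᴴ)ᴴ))) (tCoefA η (gaugePair τ fun μ x => coordMat e (ContinuousLinearMap.mulLeftRight ℝ (Matrix m m ℂ) (u k x * U μ x * (u k (τ μ x))ᴴ) (u k x * U μ x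 * (u k (τ μ x))ᴴ)ᴴ))) + NV k ∘ₗ projO none) - mulOp (fun p : X × ι => ψX k p.1) ∘ₗ (unstackM (tCoefC η (gaugePair τ fun μ x => coordMat e (ContinuousLinearMap.mulLeftRight ℝ (Matrix m m ℂ) (u k x * U μ x * (u k (τ μ x))ᴴ) (u k x * U μ x * (u k (τ μ x))ᴴ)ᴴ))) (tCoefA η (gaugePair τ fun μ x => coordMat e (ContinuousLinearMap.mulLeftRight ℝ (Matrix m m ℂ) (u k x * U μ x * (u k (τ μ x))ᴴ) (u k x * U μ x * (u k (τ μ x))ᴴ)ᴴ))) + NV k ∘ₗ projO none) ∘ₗ mulOp (fun q : (X × ι) × Option (J ⊕ J) => χtX k q.1.1)) ∘ₗ stack LinearMap.id (fun j => Sum.elim (fun μ => fgrad η⁻¹ (liftEquiv (τ μ) ι)) (fun μ => bgrad η⁻¹ (liftEquiv (τ μ) ι)) j))) := fun k => by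
    rw [uN_localOp_species_form e τ (u k) U η he (hu k) P, hP k, ← hVeq k, ← localOp_eq_cut_add_farDefect, LinearMap.add_comp, LinearMap.comp_assoc, projO_none_comp_stack,
      LinearMap.comp_id]
    abel
  -- THE ADJOINT LETTER `𝒲_k` by FILE 150 from the smooth-cut coefficients' letters (rows `r_V`, quotients `r_D + c̃r_V`) and the sandwiched right entries
  have hW𝒲 : ∀ k, HasMaj (BlockNorm.ofBlocks g (liftBlk blk ι)) (BlockNorm.ofBlocks g (liftBlk blk ι)) ((mulOp (fun p : X × ι => χtX k p.1) ∘ₗ N k) ∘ₗ (unstackM (fun x => χtX k x • (tCoefC η (gaugePair τ fun μ x => coordMat e (ContinuousLinearMap.mulLeftRight ℝ (Matrix m m ℂ) (u k x * U μ x * (u k (τ μ x))ᴴ) (u k x * U μ x * (u k (τ μ x))ᴴ)ᴴ))) x) (fun μ x => χtX k x • (tCoefA η (gaugePair τ fun μ x => coordMat e (ContinuousLinearMap.mulLeftRight ℝ (Matrix m m ℂ) (u k x * U μ x * (u k (τ μ x))ᴴ) (u k x * U μ x * (u k (τ μ x))ᴴ)ᴴ))) μ x) + (mulOp (fun p : X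 × ι => ψX k p.1) ∘ₗ NV k ∘ₗ mulOp (fun p : X × ι => χtX k p.1)) ∘ₗ projO (none : Option (J ⊕ J))) ∘ₗ stack LinearMap.id (fun j => Sum.elim (fun μ => fgrad η⁻¹ (liftEquiv (τ μ) ι)) (fun μ => bgrad η⁻¹ (liftEquiv (τ μ) ι)) j) ∘ₗ mulOp (fun p : X × ι => χX k p.1)) (fun y y' => (β * rV + Fintype.card J * (2 * (βQ * rV + β * (rD + ct * rV))) + β * RN * cr) * Real.exp (-(ρ₁ * g.dist y y'))) := fun k =>
    (hasMaj_adjW_smoothCut_loc₂ blk τ η⁻¹ htri hd hrow hβ hβQ hrV hrV (by positivity) hRN hcr (le_trans hσ hσρ) (by linarith) hρ₁G hρ₁V (hSχ k) (hχt k) (hχ1 k) (hsub k) (hχ k) (hcut k)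
      (hTf k) (hTb k) (hTfr k) (hTbr k) (hCk k) (fun μ x i => hAk k (Sum.inl μ) x i) (fun μ x i => hAk k (Sum.inr μ) x i) (hgAf k) (hgAb k) (hNVk k)).mono fun y y' =>
      mul_le_of_le_one_left (by positivity) (mul_le_one₀ (ind_le_one _ _) (ind_nonneg _ _) (ind_le_one _ _))
  -- the units of the dressed cubes, the adjoint unit, the derived pieces (as in FILE 163)
  have hGf := fun k => hasMaj_smoothCut_flat blk (S := Sk k) hβ hβ₁ hct (hχt k) (hsub k) (hcut k)
  have hDf := fun k => hasMaj_jet_smoothCut_flat blk τ η⁻¹ (S := Sk k) hβ hβ₁ hct (hχt k) (hdχt k) (hdχtb k) (hs k) (hsb k) (hdd k) (hddb k) (hcut k) (hcutF k) (hcutB k)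
  have hunit := fun k => (hasMaj_dressedV_pair blk htri hd hrow hσ hβb hR hcr hσρ hρ₁V hρ₁G hρ₂ (by linarith) (hGf k) (hDf k) (hV k) hq).1
  have hunitW := fun k => isUnit_neumannR (liftBlk blk ι) hd hrow (by positivity : (0:ℝ) ≤ (β * rV + Fintype.card J * (2 * (βQ * rV + β * (rD + ct * rV))) + β * RN * cr)) hσρ (hW𝒲 k) hqA
  have hDj : ∀ k, ∀ j, (fun j => Sum.elim (fun μ => fgrad η⁻¹ (liftEquiv (τ μ) ι)) (fun μ => bgrad η⁻¹ (liftEquiv (τ μ) ι)) j ∘ₗ (mulOp (fun p : X × ι => χtX k p.1) ∘ₗ N k)) j = (fun j => Sum.elim (fun μ => fgrad η⁻¹ (liftEquiv (τ μ) ι)) (fun μ => bgrad η⁻¹ (liftEquiv (τ μ) ι)) j) j ∘ₗ (mulOp (fun p : X × ι => χtX k p.1) ∘ₗ N k) := fun _ _ => rfl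
  -- the jet of `h_k`-cut fields is `χ̃_k`-localized; the dressed cube absorbs `M_ψ`
  have hY : ∀ k, mulOp (fun q : (X × ι) × Option (J ⊕ J) => χtX k q.1.1) ∘ₗ (stack LinearMap.id (fun j => Sum.elim (fun μ => fgrad η⁻¹ (liftEquiv (τ μ) ι)) (fun μ => bgrad η⁻¹ (liftEquiv (τ μ) ι)) j) ∘ₗ mulOp (fun p : X × ι => hX k p.1)) = stack LinearMap.id (fun j => Sum.elim (fun μ => fgrad η⁻¹ (liftEquiv (τ μ) ι)) (fun μ => bgrad η⁻¹ (liftEquiv (τ μ) ι)) j) ∘ₗ mulOp (fun p : X × ι => hX k p.1) := fun k => by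
    have h := jetCut_comp_jet_mulOp_comp τ η⁻¹ (hχth k) (hhts' k) (hhtsb' k) (hhtdd' k) (hhtddb' k) (LinearMap.id : (X × ι → ℝ) →ₗ[ℝ] (X × ι → ℝ))
    simpa only [LinearMap.comp_id] using h
  -- the TWO ADJOINT FAR ROWS: `X_k∘F_k∘M_h = 0` and `X_k∘[F_k, M_h] = X_k∘M_h∘N_V∘(1 − M_χ̃)`
  have hXF0 : ∀ k, (projO none ∘ₗ bgPropV (stack (mulOp (fun p : X × ι => χtX k p.1) ∘ₗ N k) (fun j => Sum.elim (fun μ => fgrad η⁻¹ (liftEquiv (τ μ) ι)) (fun μ => bgrad η⁻¹ (liftEquiv (τ μ) ι)) j ∘ₗ (mulOp (fun p : X × ι => χtX k p.1) ∘ₗ N k))) (unstackM (fun x => χtX k x • (tCoefC η (gaugePair τ fun μ x => coordMat e (ContinuousLinearMap.mulLeftRight ℝ (Matrix m m ℂ) (u k x * U μ x * (u k (τ μ x))ᴴ) (u k x * U μ x * (u k (τ μ x))ᴴ)ᴴ))) x) (fun μ x => χtX k x • (tCoefA η (gaugePair τ fun μ x => coordMat e (ContinuousLinearMap.mulLeftRight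 ℝ (Matrix m m ℂ) (u k x * U μ x * (u k (τ μ x))ᴴ) (u k x * U μ x * (u k (τ μ x))ᴴ)ᴴ))) μ x) + (mulOp (fun p : X × ι => ψX k p.1) ∘ₗ NV k ∘ₗ mulOp (fun p : X × ι => χtX k p.1)) ∘ₗ projO (none : Option (J ⊕ J)))) ∘ₗ (-(((unstackM (tCoefC η (gaugePair τ fun μ x => coordMat e (ContinuousLinearMap.mulLeftRight ℝ (Matrix m m ℂ) (u k x * U μ x * (u k (τ μ x))ᴴ) (u k x * U μ x * (u k (τ μ x))ᴴ)ᴴ))) (tCoefA η (gaugePair τ fun μ x => coordMat e (ContinuousLinearMap.mulLeftRight ℝ (Matrix m m ℂ) (u k x * U μ x * (u k (τ μ x))ᴴ) (u k x * U μ x * (u k (τ μ x))ᴴ)ᴴ))) + NV k ∘ₗ projO none) - mulOp (fun p : X × ι => ψX k p.1) ∘ₗ (unstackM (tCoefC η (gaugePair τ fun μ x => coordMat e (ContinuousLinearMap.mulLeftRight ℝ (Matrix m m ℂ) (u k x * U μ x * (u k (τ μ x))ᴴ) (u k x * U μ x * (u k (τ μ x))ᴴ)ᴴ))) (tCoefA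 η (gaugePair τ fun μ x => coordMat e (ContinuousLinearMap.mulLeftRight ℝ (Matrix m m ℂ) (u k x * U μ x * (u k (τ μ x))ᴴ) (u k x * U μ x * (u k (τ μ x))ᴴ)ᴴ))) + NV k ∘ₗ projO none) ∘ₗ mulOp (fun q : (X × ι) × Option (J ⊕ J) => χtX k q.1.1)) ∘ₗ stack LinearMap.id (fun j => Sum.elim (fun μ => fgrad η⁻¹ (liftEquiv (τ μ) ι)) (fun μ => bgrad η⁻¹ (liftEquiv (τ μ) ι)) j))) ∘ₗ mulOp (fun p : X × ι => hX k p.1) = 0 := fun k =>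
    projO_dressedV_comp_farDefect_mulOp (hDj k) (hunit k) (smoothCut_comp_mulOp_in (hNψ k)) (unstackM (tCoefC η (gaugePair τ fun μ x => coordMat e (ContinuousLinearMap.mulLeftRight ℝ (Matrix m m ℂ) (u k x * U μ x * (u k (τ μ x))ᴴ) (u k x * U μ x * (u k (τ μ x))ᴴ)ᴴ))) (tCoefA η (gaugePair τ fun μ x => coordMat e (ContinuousLinearMap.mulLeftRight ℝ (Matrix m m ℂ) (u k x * U μ x * (u k (τ μ x))ᴴ) (u k x * U μ x * (u k (τ μ x))ᴴ)ᴴ))) + NV k ∘ₗ projO none) (hY k)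
  have hFX : ∀ k, HasMaj (BlockNorm.ofBlocks g (liftBlk blk ι)) (BlockNorm.ofBlocks g (liftBlk blk ι)) ((projO none ∘ₗ bgPropV (stack (mulOp (fun p : X × ι => χtX k p.1) ∘ₗ N k) (fun j => Sum.elim (fun μ => fgrad η⁻¹ (liftEquiv (τ μ) ι)) (fun μ => bgrad η⁻¹ (liftEquiv (τ μ) ι)) j ∘ₗ (mulOp (fun p : X × ι => χtX k p.1) ∘ₗ N k))) (unstackM (fun x => χtX k x • (tCoefC η (gaugePair τ fun μ x => coordMat e (ContinuousLinearMap.mulLeftRight ℝ (Matrix m m ℂ) (u k x * U μ x * (u k (τ μ x))ᴴ) (u k x * U μ x * (u k (τ μ x))ᴴ)ᴴ))) x) (fun μ x => χtX k x • (tCoefA η (gaugePair τ fun μ x => coordMat e (ContinuousLinearMap.mulLeftRight ℝ (Matrix m m ℂ) (u k x * U μ x * (u k (τ μ x))ᴴ) (u k x * U μ x * (u k (τ μ x))ᴴ)ᴴ))) μ x) + (mulOp (fun p : X × ι => ψX k p.1) ∘ₗ NV k ∘ₗ mulOp (fun p : X × ι => χtX k p.1)) ∘ₗ projO (none : Option (J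 ⊕ J)))) ∘ₗ (-(((unstackM (tCoefC η (gaugePair τ fun μ x => coordMat e (ContinuousLinearMap.mulLeftRight ℝ (Matrix m m ℂ) (u k x * U μ x * (u k (τ μ x))ᴴ) (u k x * U μ x * (u k (τ μ x))ᴴ)ᴴ))) (tCoefA η (gaugePair τ fun μ x => coordMat e (ContinuousLinearMap.mulLeftRight ℝ (Matrix m m ℂ) (u k x * U μ x * (u k (τ μ x))ᴴ) (u k x * U μ x * (u k (τ μ x))ᴴ)ᴴ))) + NV k ∘ₗ projO none) - mulOp (fun p : X × ι => ψX k p.1) ∘ₗ (unstackM (tCoefC η (gaugePair τ fun μ x => coordMat e (ContinuousLinearMap.mulLeftRight ℝ (Matrix m m ℂ) (u k x * U μ x * (u k (τ μ x))ᴴ) (u k x * U μ x * (u k (τ μ x))ᴴ)ᴴ))) (tCoefA η (gaugePair τ fun μ x => coordMat e (ContinuousLinearMap.mulLeftRight ℝ (Matrix m m ℂ) (u k x * U μ x * (u k (τ μ x))ᴴ) (u k x * U μ x * (u k (τ μ x))ᴴ)ᴴ))) + NV k ∘ₗ projO none) ∘ₗ mulOp (fun q : (X × ι) × Option (J ⊕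 J) => χtX k q.1.1)) ∘ₗ stack LinearMap.id (fun j => Sum.elim (fun μ => fgrad η⁻¹ (liftEquiv (τ μ) ι)) (fun μ => bgrad η⁻¹ (liftEquiv (τ μ) ι)) j))) ∘ₗ mulOp (fun p : X × ι => hX k p.1))
      (fun y y' => ind (Sk k) y * ind (Sk k) y' * (0 * Real.exp (-(ρ₃ * g.dist y y')))) := fun k => by
    rw [hXF0 k]; exact (hasMaj_zero _ _).mono fun y y' => le_of_eq (by ring)
  have hXr : ∀ k, HasMaj (BlockNorm.ofBlocks g (liftBlk blk ι)) (BlockNorm.ofBlocks g (liftBlk blk ι)) (projO none ∘ₗ bgPropV (stack (mulOp (fun p : X × ι => χtX k p.1) ∘ₗ N k) (fun j => Sum.elim (fun μ => fgrad η⁻¹ (liftEquiv (τ μ) ι)) (fun μ => bgrad η⁻¹ (liftEquiv (τ μ) ι)) j ∘ₗ (mulOp (fun p : X × ι => χtX k p.1) ∘ₗ N k))) (unstackM (fun x => χtX k x • (tCoefC η (gaugePair τ fun μ x => coordMat e (ContinuousLinearMap.mulLeftRight ℝ (Matrix m m ℂ) (u k x * U μ x * (u k (τ μ x))ᴴ)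 (u k x * U μ x * (u k (τ μ x))ᴴ)ᴴ))) x) (fun μ x => χtX k x • (tCoefA η (gaugePair τ fun μ x => coordMat e (ContinuousLinearMap.mulLeftRight ℝ (Matrix m m ℂ) (u k x * U μ x * (u k (τ μ x))ᴴ) (u k x * U μ x * (u k (τ μ x))ᴴ)ᴴ))) μ x) + (mulOp (fun p : X × ι => ψX k p.1) ∘ₗ NV k ∘ₗ mulOp (fun p : X × ι => χtX k p.1)) ∘ₗ projO (none : Option (J ⊕ J))))
      (fun y y' => ind (Sk k) y * ind (Sk k) y' * (((β + (β₁ + ct * β)) * (1 - (β + (β₁ + ct * β)) * (R * cr) * cr)⁻¹) * Real.exp (-(ρ₂ * g.dist y y')))) := fun k =>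
    hasMaj_smoothCutDressed_loc₂ blk τ η⁻¹ htri hd hrow hσ hβ hβ₁ hct hR hcr hσρ hρ₁V hρ₁G hρ₂ (by linarith) (hSχ k) (hSψ k) (hχt k) (hdχt k) (hdχtb k) (hsub k) (hχ k) (hs k)
      (hsb k) (hdd k) (hddb k) (hNψ k) (hcut k) (hcutF k) (hcutB k) (hV k) hq
  have hFK : ∀ k, HasMaj (BlockNorm.ofBlocks g (liftBlk blk ι)) (BlockNorm.ofBlocks g (liftBlk blk ι)) ((projO none ∘ₗ bgPropV (stack (mulOp (fun p : X × ι => χtX k p.1) ∘ₗ N k) (fun j => Sum.elim (fun μ => fgrad η⁻¹ (liftEquiv (τ μ) ι)) (fun μ => bgrad η⁻¹ (liftEquiv (τ μ) ι)) j ∘ₗ (mulOp (fun p : X × ι => χtX k p.1) ∘ₗ N k))) (unstackM (fun x => χtX k x • (tCoefC η (gaugePair τ fun μ x => coordMat e (ContinuousLinearMap.mulLeftRight ℝ (Matrix m m ℂ) (u k x * U μ x * (u k (τ μ x))ᴴ) (u k x * U μ x * (u k (τ μ x))ᴴ)ᴴ))) x) (fun μ x => χtX k x • (tCoefA η (gaugePair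 τ fun μ x => coordMat e (ContinuousLinearMap.mulLeftRight ℝ (Matrix m m ℂ) (u k x * U μ x * (u k (τ μ x))ᴴ) (u k x * U μ x * (u k (τ μ x))ᴴ)ᴴ))) μ x) + (mulOp (fun p : X × ι => ψX k p.1) ∘ₗ NV k ∘ₗ mulOp (fun p : X × ι => χtX k p.1)) ∘ₗ projO (none : Option (J ⊕ J)))) ∘ₗ commOp (-(((unstackM (tCoefC η (gaugePair τ fun μ x => coordMat e (ContinuousLinearMap.mulLeftRight ℝ (Matrix m m ℂ) (u k x * U μ x * (u k (τ μ x))ᴴ) (u k x * U μ x * (u k (τ μ x))ᴴ)ᴴ))) (tCoefA η (gaugePair τ fun μ x => coordMat e (ContinuousLinearMap.mulLeftRight ℝ (Matrix m m ℂ) (u k x * U μ x * (u k (τ μ x))ᴴ) (u k x * U μ x * (u k (τ μ x))ᴴ)ᴴ))) + NV k ∘ₗ projO none) - mulOp (fun p : X × ι => ψX k p.1) ∘ₗ (unstackM (tCoefC η (gaugePair τ fun μ x => coordMat e (ContinuousLinearMap.mulLeftRight ℝ (Matrix m m ℂ) (u k x * U μ x * (u k (τ μ x))ᴴ) (u k x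 * U μ x * (u k (τ μ x))ᴴ)ᴴ))) (tCoefA η (gaugePair τ fun μ x => coordMat e (ContinuousLinearMap.mulLeftRight ℝ (Matrix m m ℂ) (u k x * U μ x * (u k (τ μ x))ᴴ) (u k x * U μ x * (u k (τ μ x))ᴴ)ᴴ))) + NV k ∘ₗ projO none) ∘ₗ mulOp (fun q : (X × ι) × Option (J ⊕ J) => χtX k q.1.1)) ∘ₗ stack LinearMap.id (fun j => Sum.elim (fun μ => fgrad η⁻¹ (liftEquiv (τ μ) ι)) (fun μ => bgrad η⁻¹ (liftEquiv (τ μ) ι)) j))) (fun p : X × ι => hX k p.1))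
      (fun y y' => ind (Sk k) y * ((((β + (β₁ + ct * β)) * (1 - (β + (β₁ + ct * β)) * (R * cr) * cr)⁻¹) * θF * cr) * Real.exp (-(ρ₃ * g.dist y y')))) := fun k => by
    rw [projO_dressedV_comp_commOp_farDefect (hDj k) (hunit k) (smoothCut_comp_mulOp_in (hNψ k)) (hhψ k) (unstackM (tCoefC η (gaugePair τ fun μ x => coordMat e (ContinuousLinearMap.mulLeftRight ℝ (Matrix m m ℂ) (u k x * U μ x * (u k (τ μ x))ᴴ) (u k x * U μ x * (u k (τ μ x))ᴴ)ᴴ))) (tCoefA η (gaugePair τ fun μ x => coordMat e (ContinuousLinearMap.mulLeftRight ℝ (Matrix m m ℂ) (u k x * U μ x * (u k (τ μ x))ᴴ) (u k x * U μ x * (u k (τ μ x))ᴴ)ᴴ))) + NV k ∘ₗ projO none) (hY k),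
      mulOp_comp_cutPert_comp_sub_jetCut_comp_jet τ η⁻¹ (tCoefC η (gaugePair τ fun μ x => coordMat e (ContinuousLinearMap.mulLeftRight ℝ (Matrix m m ℂ) (u k x * U μ x * (u k (τ μ x))ᴴ) (u k x * U μ x * (u k (τ μ x))ᴴ)ᴴ))) (tCoefA η (gaugePair τ fun μ x => coordMat e (ContinuousLinearMap.mulLeftRight ℝ (Matrix m m ℂ) (u k x * U μ x * (u k (τ μ x))ᴴ) (u k x * U μ x * (u k (τ μ x))ᴴ)ᴴ))) (NV k) (hχth k)]
    have hXo : HasMaj (BlockNorm.ofBlocks g (liftBlk blk ι)) (BlockNorm.ofBlocks g (liftBlk blk ι)) (projO none ∘ₗ bgPropV (stack (mulOp (fun p : X × ι => χtX k p.1) ∘ₗ N k) (fun j => Sum.elim (fun μ => fgrad η⁻¹ (liftEquiv (τ μ) ι)) (fun μ => bgrad η⁻¹ (liftEquiv (τ μ) ι)) j ∘ₗ (mulOp (fun p : X × ι => χtX k p.1) ∘ₗ N k))) (unstackM (fun x => χtX k x • (tCoefC η (gaugePair τ fun μ x => coordMat e (ContinuousLinearMap.mulLeftRight ℝ (Matrix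 m m ℂ) (u k x * U μ x * (u k (τ μ x))ᴴ) (u k x * U μ x * (u k (τ μ x))ᴴ)ᴴ))) x) (fun μ x => χtX k x • (tCoefA η (gaugePair τ fun μ x => coordMat e (ContinuousLinearMap.mulLeftRight ℝ (Matrix m m ℂ) (u k x * U μ x * (u k (τ μ x))ᴴ) (u k x * U μ x * (u k (τ μ x))ᴴ)ᴴ))) μ x) + (mulOp (fun p : X × ι => ψX k p.1) ∘ₗ NV k ∘ₗ mulOp (fun p : X × ι => χtX k p.1)) ∘ₗ projO (none : Option (J ⊕ J)))) (fun y y' => ind (Sk k) y * (((β + (β₁ + ct * β)) * (1 - (β + (β₁ + ct * β)) * (R * cr) * cr)⁻¹) * Real.exp (-(ρ₂ * g.dist y y')))) :=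
      (hXr k).mono fun y y' => by
        have hE : 0 ≤ ind (Sk k) y * (((β + (β₁ + ct * β)) * (1 - (β + (β₁ + ct * β)) * (R * cr) * cr)⁻¹) * Real.exp (-(ρ₂ * g.dist y y'))) := mul_nonneg (ind_nonneg _ _) (mul_nonneg hB (Real.exp_nonneg _))
        calc ind (Sk k) y * ind (Sk k) y' * (((β + (β₁ + ct * β)) * (1 - (β + (β₁ + ct * β)) * (R * cr) * cr)⁻¹) * Real.exp (-(ρ₂ * g.dist y y'))) = ind (Sk k) y' * (ind (Sk k) y * (((β + (β₁ + ct * β)) * (1 - (β + (β₁ + ct * β)) * (R * cr) * cr)⁻¹) * Real.exp (-(ρ₂ * g.dist y y')))) := by ring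
          _ ≤ 1 * (ind (Sk k) y * (((β + (β₁ + ct * β)) * (1 - (β + (β₁ + ct * β)) * (R * cr) * cr)⁻¹) * Real.exp (-(ρ₂ * g.dist y y')))) := mul_le_mul_of_nonneg_right (ind_le_one _ _) hE
          _ = _ := one_mul _
    refine (hasMaj_outLoc_comp_exp (Sk k) (b₁ := BlockNorm.ofBlocks g (liftBlk blk ι)) (b₂ := BlockNorm.ofBlocks g (liftBlk blk ι)) (b₃ := BlockNorm.ofBlocks g (liftBlk blk ι)) (ρ := ρ₃)
      htri hd hrow hB hθF hρ₃ hρF hρ₃₂ hXo (hfarN k)).mono fun y y' => le_of_eq ?_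
    rw [show (BlockNorm.ofBlocks g (liftBlk blk ι)).κ = 1 from rfl]; ring
  -- the `W`-row (`W = 0`)
  have hWrow : ∀ k, HasMaj (BlockNorm.ofBlocks g (liftBlk blk ι)) (BlockNorm.ofBlocks g (liftBlk blk ι)) ((projO none ∘ₗ bgPropV (stack (mulOp (fun p : X × ι => χtX k p.1) ∘ₗ N k) (fun j => Sum.elim (fun μ => fgrad η⁻¹ (liftEquiv (τ μ) ι)) (fun μ => bgrad η⁻¹ (liftEquiv (τ μ) ι)) j ∘ₗ (mulOp (fun p : X × ι => χtX k p.1) ∘ₗ N k))) (unstackM (fun x => χtX k x • (tCoefC η (gaugePair τ fun μ x => coordMat e (ContinuousLinearMap.mulLeftRight ℝ (Matrix m m ℂ) (u k x * U μ x * (u k (τ μ x))ᴴ) (u k x * U μ x * (u k (τ μ x))ᴴ)ᴴ))) x) (fun μ x => χtX k x • (tCoefA η (gaugePair τ fun μ x => coordMat e (ContinuousLinearMap.mulLeftRight ℝ (Matrix m m ℂ) (u k x * U μ x * (u k (τ μ x))ᴴ) (u k x * U μ x * (u k (τ μ x))ᴴ)ᴴ))) μ x) + (mulOp (fun p : X ×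 ι => ψX k p.1) ∘ₗ NV k ∘ₗ mulOp (fun p : X × ι => χtX k p.1)) ∘ₗ projO (none : Option (J ⊕ J)))) ∘ₗ commOp (0 : (X × ι → ℝ) →ₗ[ℝ] (X × ι → ℝ)) (fun p : X × ι => hX k p.1))
      (fun y y' => ind (Sk k) y * ind (Sk k) y' * (0 * Real.exp (-(ρ₂ * g.dist y y')))) := fun k => by
    rw [show commOp (0 : (X × ι → ℝ) →ₗ[ℝ] (X × ι → ℝ)) (fun p : X × ι => hX k p.1) = 0 from by simp [commOp], LinearMap.comp_zero]
    exact (hasMaj_zero _ _).mono fun y y' => le_of_eq (by ring)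
  -- the adjoint remainder row in the cube's gauge: FILE 153 ★★★ against the model operator plus the far row (as in FILE 163∕n15-c∕280)
  have hK' : ∀ k, HasMaj (BlockNorm.ofBlocks g (liftBlk blk ι)) (BlockNorm.ofBlocks g (liftBlk blk ι)) ((projO none ∘ₗ bgPropV (stack (mulOp (fun p : X × ι => χtX k p.1) ∘ₗ N k) (fun j => Sum.elim (fun μ => fgrad η⁻¹ (liftEquiv (τ μ) ι)) (fun μ => bgrad η⁻¹ (liftEquiv (τ μ) ι)) j ∘ₗ (mulOp (fun p : X × ι => χtX k p.1) ∘ₗ N k))) (unstackM (fun x => χtX k x • (tCoefC η (gaugePair τ fun μ x => coordMat e (ContinuousLinearMap.mulLeftRight ℝ (Matrix m m ℂ) (u k x * U μ x * (u k (τ μ x))ᴴ) (u k x * U μ x * (u k (τ μ x))ᴴ)ᴴ))) x) (fun μ x => χtX k x • (tCoefA η (gaugePair τ fun μ x => coordMat e (ContinuousLinearMap.mulLeftRight ℝ (Matrix m m ℂ) (u k x * U μ x * (u k (τ μ x))ᴴ) (u k x * U μ x * (u k (τ μ x))ᴴ)ᴴ))) μ x) + (mulOp (fun p : X × ι => ψX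 k p.1) ∘ₗ NV k ∘ₗ mulOp (fun p : X × ι => χtX k p.1)) ∘ₗ projO (none : Option (J ⊕ J)))) ∘ₗ commOp (mmulOp (fun x => coordMat e (ContinuousLinearMap.mulLeftRight ℝ (Matrix m m ℂ) (u k x) (u k x)ᴴ)) ∘ₗ (covLapM τ η (gaugePair τ (fun μ x => coordMat e (ContinuousLinearMap.mulLeftRight ℝ (Matrix m m ℂ) (U μ x) (U μ x)ᴴ))) + P) ∘ₗ mmulOp (fun x => (coordMat e (ContinuousLinearMap.mulLeftRight ℝ (Matrix m m ℂ) (u k x) (u k x)ᴴ))ᵀ)) (fun p : X × ι => hX k p.1))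
      (fun y y' => ind (Sk k) y * (((((((Fintype.card J : ℝ) * (3 * ((β + (β₁ + ct * β)) * (1 - (β + (β₁ + ct * β)) * (R * cr) * cr)⁻¹ * c₂) + 2 * (((1 - (β * rV + Fintype.card J * (2 * (βQ * rV + β * (rD + ct * rV))) + β * RN * cr) * cr)⁻¹ * βQ * cr) * c₁)) + 0)
          + (β + (β₁ + ct * β)) * (1 - (β + (β₁ + ct * β)) * (R * cr) * cr)⁻¹ * cN * cr)
        + (((Fintype.card J : ℝ) * (2 * rV * (c₁ * ((β + (β₁ + ct * β)) * (1 - (β + (β₁ + ct * β)) * (R * cr) * cr)⁻¹) + c₀ * ((1 - (β * rV + Fintype.card J * (2 * (βQ * rV + β * (rD + ct * rV))) + β * RN * cr) * cr)⁻¹ * βQ * cr))))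
          + (β + (β₁ + ct * β)) * (1 - (β + (β₁ + ct * β)) * (R * cr) * cr)⁻¹ * ((ℓ * (Real.exp 1 * ε)⁻¹ + 2 * ω) * RN) * cr))) + (((β + (β₁ + ct * β)) * (1 - (β + (β₁ + ct * β)) * (R * cr) * cr)⁻¹) * θF * cr)) * Real.exp (-(ρ₃ * g.dist y y')))) := fun k => by
    rw [hcov k, commOp_add_left, LinearMap.comp_add]
    have h153 := hasMaj_smoothCutDressed_comp_commOp_cubeOp_out_of_sandwich blk τ η⁻¹ htri hd hsymm hd0 hrow hσ hβ hβ₁ hβQ hct hR hcr hc₀ hc₁ hc₂ le_rfl hcN hrV hRN hℓ hω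
      (by positivity : (0:ℝ) ≤ (β * rV + Fintype.card J * (2 * (βQ * rV + β * (rD + ct * rV))) + β * RN * cr)) hε hσρ hρ₁V hρ₁G hρ₂ (by linarith) hρ₃ (by linarith) (by linarith) hρ₃₂ hρ₂₁ (hSχ k) (hSψ k) (hSψ₂ k) (hχt k) (hdχt k) (hdχtb k) (hsub k) (hχ k)
      (hs k) (hsb k) (hdd k) (hddb k) (hNψ k) (hcut k) (hcutF k) (hcutB k) (hTf k) (hTb k) (hTfr₁ k) (hTbr₁ k) (hTfψ k) (hTbψ k) (hV k) hq (hW𝒲 k) hqA (hh1 k) (hh1b k) (hh0 k)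
      (hLip k) (hrh k) (hh2 k) (hh2f k) (hh2b k) (hlayf k) (hlayb k) (fun j x i => hAk k j x i) (hWrow k) (hKN k) (hNVk k)
    exact (h153.add (hFK k)).mono fun y y' => le_of_eq (by ring)
  -- the right locality with defect, exactly: `X_k∘Δ^{u_k}∘M_h = M_h + X_k∘F_k∘M_h`
  have hloc' : ∀ k, (projO none ∘ₗ bgPropV (stack (mulOp (fun p : X × ι => χtX k p.1) ∘ₗ N k) (fun j => Sum.elim (fun μ => fgrad η⁻¹ (liftEquiv (τ μ) ι)) (fun μ => bgrad η⁻¹ (liftEquiv (τ μ) ι)) j ∘ₗ (mulOp (fun p : X × ι => χtX k p.1) ∘ₗ N k))) (unstackM (fun x => χtX k x • (tCoefC η (gaugePair τ fun μ x => coordMat e (ContinuousLinearMap.mulLeftRight ℝ (Matrix m m ℂ) (u k x * U μ x * (u k (τ μ x))ᴴ) (u k x * U μ x * (u k (τ μ x))ᴴ)ᴴ))) x) (fun μ x => χtX k x • (tCoefA η (gaugePair τ fun μ x => coordMat e (ContinuousLinearMap.mulLeftRight ℝ (Matrix m m ℂ) (u k x * U μ x * (u k (τ μ x))ᴴ) (u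 k x * U μ x * (u k (τ μ x))ᴴ)ᴴ))) μ x) + (mulOp (fun p : X × ι => ψX k p.1) ∘ₗ NV k ∘ₗ mulOp (fun p : X × ι => χtX k p.1)) ∘ₗ projO (none : Option (J ⊕ J)))) ∘ₗ (mmulOp (fun x => coordMat e (ContinuousLinearMap.mulLeftRight ℝ (Matrix m m ℂ) (u k x) (u k x)ᴴ)) ∘ₗ (covLapM τ η (gaugePair τ (fun μ x => coordMat e (ContinuousLinearMap.mulLeftRight ℝ (Matrix m m ℂ) (U μ x) (U μ x)ᴴ))) + P) ∘ₗ mmulOp (fun x => (coordMat e (ContinuousLinearMap.mulLeftRight ℝ (Matrix m m ℂ) (u k x) (u k x)ᴴ))ᵀ)) ∘ₗ mulOp (fun p : X × ι => hX k p.1) =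
      mulOp (fun p : X × ι => hX k p.1) + ((projO none ∘ₗ bgPropV (stack (mulOp (fun p : X × ι => χtX k p.1) ∘ₗ N k) (fun j => Sum.elim (fun μ => fgrad η⁻¹ (liftEquiv (τ μ) ι)) (fun μ => bgrad η⁻¹ (liftEquiv (τ μ) ι)) j ∘ₗ (mulOp (fun p : X × ι => χtX k p.1) ∘ₗ N k))) (unstackM (fun x => χtX k x • (tCoefC η (gaugePair τ fun μ x => coordMat e (ContinuousLinearMap.mulLeftRight ℝ (Matrix m m ℂ) (u k x * U μ x * (u k (τ μ x))ᴴ) (u k x * U μ x * (u k (τ μ x))ᴴ)ᴴ))) x) (fun μ x => χtX k x • (tCoefA η (gaugePair τ fun μ x => coordMat e (ContinuousLinearMap.mulLeftRight ℝ (Matrix m m ℂ) (u k x * U μ x * (u k (τ μ x))ᴴ) (u k x * U μ x * (u k (τ μ x))ᴴ)ᴴ))) μ x) + (mulOp (fun p : X × ι => ψX k p.1) ∘ₗ NV k ∘ₗ mulOp (fun p : X × ι => χtX k p.1)) ∘ₗ projO (none : Option (J ⊕ J)))) ∘ₗ (-(((unstackM (tCoefC η (gaugePair τ fun μ x => coordMat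 e (ContinuousLinearMap.mulLeftRight ℝ (Matrix m m ℂ) (u k x * U μ x * (u k (τ μ x))ᴴ) (u k x * U μ x * (u k (τ μ x))ᴴ)ᴴ))) (tCoefA η (gaugePair τ fun μ x => coordMat e (ContinuousLinearMap.mulLeftRight ℝ (Matrix m m ℂ) (u k x * U μ x * (u k (τ μ x))ᴴ) (u k x * U μ x * (u k (τ μ x))ᴴ)ᴴ))) + NV k ∘ₗ projO none) - mulOp (fun p : X × ι => ψX k p.1) ∘ₗ (unstackM (tCoefC η (gaugePair τ fun μ x => coordMat e (ContinuousLinearMap.mulLeftRight ℝ (Matrix m m ℂ) (u k x * U μ x * (u k (τ μ x))ᴴ) (u k x * U μ x * (u k (τ μ x))ᴴ)ᴴ))) (tCoefA η (gaugePair τ fun μ x => coordMat e (ContinuousLinearMap.mulLeftRight ℝ (Matrix m m ℂ) (u k x * U μ x * (u k (τ μ x))ᴴ) (u k x * U μ x * (u k (τ μ x))ᴴ)ᴴ))) + NV k ∘ₗ projO none) ∘ₗ mulOp (fun q : (X × ι) × Option (J ⊕ J) => χtX k q.1.1)) ∘ₗ stack LinearMap.id (fun j => Sum.elim (fun μ =>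 fgrad η⁻¹ (liftEquiv (τ μ) ι)) (fun μ => bgrad η⁻¹ (liftEquiv (τ μ) ι)) j))) ∘ₗ mulOp (fun p : X × ι => hX k p.1)) := fun k => by
    have h148 := projO_dressedV_comp_lap_mulOp (hDj k) (hunit k) (smoothCut_out (hχ k)) (hunitW k) (Δ₀ := lapOp η⁻¹ (fun μ => liftEquiv (τ μ) ι) 0 + NL)
      (Vt := (unstackM (fun x => χtX k x • (tCoefC η (gaugePair τ fun μ x => coordMat e (ContinuousLinearMap.mulLeftRight ℝ (Matrix m m ℂ) (u k x * U μ x * (u k (τ μ x))ᴴ) (u k x * U μ x * (u k (τ μ x))ᴴ)ᴴ))) x) (fun μ x => χtX k x • (tCoefA η (gaugePair τ fun μ x => coordMat e (ContinuousLinearMap.mulLeftRight ℝ (Matrix m m ℂ) (u k x * U μ x * (u k (τ μ x))ᴴ) (u k x * U μ x * (u k (τ μ x))ᴴ)ᴴ))) μ x) + (mulOp (fun p : X × ι => ψX k p.1) ∘ₗ NV k ∘ₗ mulOp (fun p : X × ι => χtX k p.1)) ∘ₗ projO (none : Option (J ⊕ J))) ∘ₗ stack LinearMap.id (fun j => Sum.elim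 (fun μ => fgrad η⁻¹ (liftEquiv (τ μ) ι)) (fun μ => bgrad η⁻¹ (liftEquiv (τ μ) ι)) j)) (Vm := 0) (F := 0) (h := fun p : X × ι => hX k p.1) (Δ := (lapOp η⁻¹ (fun μ => liftEquiv (τ μ) ι) 0 + NL - (unstackM (fun x => χtX k x • (tCoefC η (gaugePair τ fun μ x => coordMat e (ContinuousLinearMap.mulLeftRight ℝ (Matrix m m ℂ) (u k x * U μ x * (u k (τ μ x))ᴴ) (u k x * U μ x * (u k (τ μ x))ᴴ)ᴴ))) x) (fun μ x => χtX k x • (tCoefA η (gaugePair τ fun μ x => coordMat e (ContinuousLinearMap.mulLeftRight ℝ (Matrix m m ℂ) (u k x * U μ x * (u k (τ μ x))ᴴ) (u k x * U μ x * (u k (τ μ x))ᴴ)ᴴ))) μ x) + (mulOp (fun p : X × ι => ψX k p.1) ∘ₗ NV k ∘ₗ mulOp (fun p : X × ι => χtX k p.1)) ∘ₗ projO (none : Option (J ⊕ J))) ∘ₗ stack LinearMap.id (fun j => Sum.elim (fun μ => fgrad η⁻¹ (liftEquiv (τ μ) ι)) (fun μ => bgrad η⁻¹ (liftEquiv (τ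 μ) ι)) j))) rfl (by rw [add_zero]; exact hflat0 k) (by rw [add_zero]) (by rw [LinearMap.comp_zero])
    rw [LinearMap.comp_zero, LinearMap.comp_zero, add_zero, add_zero] at h148
    rw [hcov k, LinearMap.add_comp, LinearMap.comp_add, h148]
  refine ⟨?_, ?_⟩
  · exact hasMaj_gluedL_comp_smoothCutDressed_localGauges_cov blk τ η⁻¹ ν htri hd hsymm hd0 hrow hσ hβ hβ₁ hβQ hct hR hcr hc₀ hc₁ hc₂ le_rfl hcN hrV hRN hℓ hω (by positivity) (by positivity)
      le_rfl hrR hrR' hrB hNov hε hσρ hρ₁V hρ₁G hρ₂ (by linarith) hρ₃ (by linarith) (by linarith) hρ₃₂ hρ₂₁ hσρ₃ hSχ hSψ hSψ₂ hχt hχ1 hdχt hdχtb hsub hχ hs hsb hdd hddb hNψ hcut hcutF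
      hcutB hTf hTb hTfr₁ hTbr₁ hTfψ hTbψ hV hq hW𝒲 hqA hhabs hhcut hh1 hh1b hh0 hLip hrh hh2 hh2f hh2b hlayf hlayb hlayν (fun k j x i => hAk k j x i) hWrow hKN hNVk hN hug hug' hcov hFK hFX
      hleib hdh hEcov hRE hRE' hBE hqL
  · exact gluedL_inverse_of_localGauges blk Sk (fun k => (fun x => coordMat e (ContinuousLinearMap.mulLeftRight ℝ (Matrix m m ℂ) (u k x) (u k x)ᴴ))) (covLapM τ η (gaugePair τ (fun μ x => coordMat e (ContinuousLinearMap.mulLeftRight ℝ (Matrix m m ℂ) (U μ x) (U μ x)ᴴ))) + P) hX (fun k => (projO none ∘ₗ bgPropV (stack (mulOp (fun p : X × ι => χtX k p.1) ∘ₗ N k) (fun j => Sum.elim (fun μ => fgrad η⁻¹ (liftEquiv (τ μ) ι)) (fun μ => bgrad η⁻¹ (liftEquiv (τ μ) ι)) j ∘ₗ (mulOp (fun p : X × ι => χtX k p.1) ∘ₗ N k))) (unstackM (fun x => χtX k x • (tCoefC η (gaugePair τ fun μ x => coordMat e (ContinuousLinearMap.mulLeftRight ℝ (Matrix m m ℂ)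 (u k x * U μ x * (u k (τ μ x))ᴴ) (u k x * U μ x * (u k (τ μ x))ᴴ)ᴴ))) x) (fun μ x => χtX k x • (tCoefA η (gaugePair τ fun μ x => coordMat e (ContinuousLinearMap.mulLeftRight ℝ (Matrix m m ℂ) (u k x * U μ x * (u k (τ μ x))ᴴ) (u k x * U μ x * (u k (τ μ x))ᴴ)ᴴ))) μ x) + (mulOp (fun p : X × ι => ψX k p.1) ∘ₗ NV k ∘ₗ mulOp (fun p : X × ι => χtX k p.1)) ∘ₗ projO (none : Option (J ⊕ J))))) (fun k => ((projO none ∘ₗ bgPropV (stack (mulOp (fun p : X × ι => χtX k p.1) ∘ₗ N k) (fun j => Sum.elim (fun μ => fgrad η⁻¹ (liftEquiv (τ μ) ι)) (fun μ => bgrad η⁻¹ (liftEquiv (τ μ) ι)) j ∘ₗ (mulOp (fun p : X × ι => χtX k p.1) ∘ₗ N k))) (unstackM (fun x => χtX k x • (tCoefC η (gaugePair τ fun μ x => coordMat e (ContinuousLinearMap.mulLeftRight ℝ (Matrix m m ℂ) (u k x * U μ x * (u k (τ μ x))ᴴ) (u k x * U μ x * (u k (τ μ x))ᴴ)ᴴ)))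 x) (fun μ x => χtX k x • (tCoefA η (gaugePair τ fun μ x => coordMat e (ContinuousLinearMap.mulLeftRight ℝ (Matrix m m ℂ) (u k x * U μ x * (u k (τ μ x))ᴴ) (u k x * U μ x * (u k (τ μ x))ᴴ)ᴴ))) μ x) + (mulOp (fun p : X × ι => ψX k p.1) ∘ₗ NV k ∘ₗ mulOp (fun p : X × ι => χtX k p.1)) ∘ₗ projO (none : Option (J ⊕ J)))) ∘ₗ (-(((unstackM (tCoefC η (gaugePair τ fun μ x => coordMat e (ContinuousLinearMap.mulLeftRight ℝ (Matrix m m ℂ) (u k x * U μ x * (u k (τ μ x))ᴴ) (u k x * U μ x * (u k (τ μ x))ᴴ)ᴴ))) (tCoefA η (gaugePair τ fun μ x => coordMat e (ContinuousLinearMap.mulLeftRight ℝ (Matrix m m ℂ) (u k x * U μ x * (u k (τ μ x))ᴴ) (u k x * U μ x * (u k (τ μ x))ᴴ)ᴴ))) + NV k ∘ₗ projO none) - mulOp (fun p : X × ι => ψX k p.1) ∘ₗ (unstackM (tCoefC η (gaugePair τ fun μ x => coordMat e (ContinuousLinearMap.mulLeftRight ℝ (Matrix m m ℂ) (u k x *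 U μ x * (u k (τ μ x))ᴴ) (u k x * U μ x * (u k (τ μ x))ᴴ)ᴴ))) (tCoefA η (gaugePair τ fun μ x => coordMat e (ContinuousLinearMap.mulLeftRight ℝ (Matrix m m ℂ) (u k x * U μ x * (u k (τ μ x))ᴴ) (u k x * U μ x * (u k (τ μ x))ᴴ)ᴴ))) + NV k ∘ₗ projO none) ∘ₗ mulOp (fun q : (X × ι) × Option (J ⊕ J) => χtX k q.1.1)) ∘ₗ stack LinearMap.id (fun j => Sum.elim (fun μ => fgrad η⁻¹ (liftEquiv (τ μ) ι)) (fun μ => bgrad η⁻¹ (liftEquiv (τ μ) ι)) j))) ∘ₗ mulOp (fun p : X × ι => hX k p.1))) hd hrow hug hug' (by positivity) le_rfl hNov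
      (by linarith : σ ≤ ρ₃) h236 hloc' hhabs hN hK' hFX hqL

set_option maxHeartbeats 800000 in
/-- ★★★ **HENCE: A RIGHT FACTOR OF PER-CUBE COVARIANT SHAPE THROUGH ANY RIGHT INVERSE OF `Δ_{R_U} + P`** (the direct-glued propagator, the named `G′(U)` on sites): `(Δ_{R_U} + P)∘Y = 1`
⟹ `Y∘E` obeys the bound — `Y = 𝒢_adj` (`𝒢_adj = 𝒢_adj∘(Δ∘Y) = (𝒢_adj∘Δ)∘Y`). [cite: Balaban1985BackgroundPropagators, Thm 3.1 (3.42) p.397 (entry `G′(U)∇*_U`: shape), (3.87)–(3.90) pp.409–410 (mechanism)] -/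
theorem uN_hasMaj_rightInverse_comp_localGauges_cov
    {m : Type} [Fintype m] [DecidableEq m] (e : Matrix m m ℂ ≃L[ℝ] (ι → ℝ)) {u : K → X → Matrix m m ℂ} {U : J → X → Matrix m m ℂ}
    {P : (X × ι → ℝ) →ₗ[ℝ] (X × ι → ℝ)} {NV : K → (X × ι → ℝ) →ₗ[ℝ] (X × ι → ℝ)} (η : ℝ) (htri : Triangle254 g) (hd : ∀ a b : g.Site, 0 ≤ g.dist a b) (hd0 : ∀ y : g.Site, g.dist y y = 0)
    (hsymm : ∀ y y', g.dist y y' = g.dist y' y) (hrow : RowSum g σ cr) (hσ : 0 ≤ σ) {ρ₁ ρ₂ ρ₃ ρN δV ε R c₀ c₁ c₂ cN ℓ ω βQ Nov : ℝ} (hβ : 0 ≤ β) (hβ₁ : 0 ≤ β₁) (hβQ : 0 ≤ βQ) (hct : 0 ≤ ct)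
    (hR : 0 ≤ R) (hcr : 0 ≤ cr) (hNov : 0 ≤ Nov) (hc₀ : 0 ≤ c₀) (hc₁ : 0 ≤ c₁) (hc₂ : 0 ≤ c₂) (hcN : 0 ≤ cN) (hℓ : 0 ≤ ℓ) (hω : 0 ≤ ω) (hε : 0 < ε)
    (hσρ : σ ≤ ρ₁) (hρ₁V : ρ₁ ≤ δV) (hρ₁G : ρ₁ + σ ≤ δ) (hρ₂ : 0 ≤ ρ₂) (hρ₂₁ : ρ₂ + 2 * σ ≤ ρ₁) (hρ₃ : 0 ≤ ρ₃) (hρ₃₂ : ρ₃ + σ ≤ ρ₂) (hρ₃V : ρ₃ + σ ≤ δV - ε) (hρ₃N : ρ₃ + σ ≤ ρN)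
    (hσρ₃ : 2 * σ ≤ ρ₃)
    -- per cube: supports, the bump `χ̃_k` and its insertions, the input cut-offs `ψ_k`, `ψ₂,k`
    (hSχ : ∀ k x, χX k x ≠ 0 → blk x ∈ Sk k) (hSψ : ∀ k x, ψX k x ≠ 0 → blk x ∈ Sk k) (hSψ₂ : ∀ k x, ψ₂X k x ≠ 0 → blk x ∈ Sk k) (hχt : ∀ k x, |χtX k x| ≤ 1) (hχ1 : ∀ k x, |χX k x| ≤ 1)
    (hdχt : ∀ k μ p, |fgrad η⁻¹ (liftEquiv (τ μ) ι) (fun p : X × ι => χtX k p.1) p| ≤ ct) (hdχtb : ∀ k μ p, |bgrad η⁻¹ (liftEquiv (τ μ) ι) (fun p : X × ι => χtX k p.1) p| ≤ ct)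
    (hsub : ∀ k, mulOp (fun p : X × ι => χtX k p.1) ∘ₗ mulOp (fun p : X × ι => χX k p.1) = mulOp (fun p : X × ι => χtX k p.1))
    (hχ : ∀ k, mulOp (fun p : X × ι => χX k p.1) ∘ₗ mulOp (fun p : X × ι => χtX k p.1) = mulOp (fun p : X × ι => χtX k p.1))
    (hs : ∀ k μ, mulOp ((fun p : X × ι => χtX k p.1) ∘ (liftEquiv (τ μ) ι)) ∘ₗ mulOp (fun p : X × ι => χX k p.1) = mulOp ((fun p : X × ι => χtX k p.1) ∘ (liftEquiv (τ μ) ι)))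
    (hsb : ∀ k μ, mulOp ((fun p : X × ι => χtX k p.1) ∘ (liftEquiv (τ μ) ι).symm) ∘ₗ mulOp (fun p : X × ι => χX k p.1) = mulOp ((fun p : X × ι => χtX k p.1) ∘ (liftEquiv (τ μ) ι).symm))
    (hdd : ∀ k μ, mulOp (fgrad η⁻¹ (liftEquiv (τ μ) ι) (fun p : X × ι => χtX k p.1)) ∘ₗ mulOp (fun p : X × ι => χX k p.1) = mulOp (fgrad η⁻¹ (liftEquiv (τ μ) ι) (fun p : X × ι => χtX k p.1)))
    (hddb : ∀ k μ, mulOp (bgrad η⁻¹ (liftEquiv (τ μ) ι) (fun p : X × ι => χtX k p.1)) ∘ₗ mulOp (fun p : X × ι => χX k p.1) = mulOp (bgrad η⁻¹ (liftEquiv (τ μ) ι) (fun p : X × ι => χtX k p.1)))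
    (hNψ : ∀ k, N k ∘ₗ mulOp (fun p : X × ι => ψX k p.1) = N k)
    (hψχ : ∀ k, mulOp (fun p : X × ι => ψX k p.1) ∘ₗ mulOp (fun p : X × ι => χX k p.1) = mulOp (fun p : X × ι => χX k p.1))
    -- per cube: the flat cube's cut rows, its SANDWICHED right entries with rows and input cuts, its EXACT flat right locality on the partition
    (hcut : ∀ k, HasMaj (BlockNorm.ofBlocks g (liftBlk blk ι)) (BlockNorm.ofBlocks g (liftBlk blk ι)) (mulOp (fun p : X × ι => χX k p.1) ∘ₗ N k) (fun y y' => ind (Sk k) y * ind (Sk k) y' * (β * Real.exp (-(δ * g.dist y y')))))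
    (hcutF : ∀ k μ, HasMaj (BlockNorm.ofBlocks g (liftBlk blk ι)) (BlockNorm.ofBlocks g (liftBlk blk ι)) (mulOp (fun p : X × ι => χX k p.1) ∘ₗ (fgrad η⁻¹ (liftEquiv (τ μ) ι) ∘ₗ N k)) (fun y y' => ind (Sk k) y * ind (Sk k) y' * (β₁ * Real.exp (-(δ * g.dist y y')))))
    (hcutB : ∀ k μ, HasMaj (BlockNorm.ofBlocks g (liftBlk blk ι)) (BlockNorm.ofBlocks g (liftBlk blk ι)) (mulOp (fun p : X × ι => χX k p.1) ∘ₗ (bgrad η⁻¹ (liftEquiv (τ μ) ι) ∘ₗ N k)) (fun y y' => ind (Sk k) y * ind (Sk k) y' * (β₁ * Real.exp (-(δ * g.dist y y')))))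
    (hTf : ∀ k μ, N k ∘ₗ fgrad η⁻¹ (liftEquiv (τ μ) ι) ∘ₗ mulOp (fun p : X × ι => χX k p.1) = Tf k μ ∘ₗ mulOp (fun p : X × ι => χX k p.1))
    (hTb : ∀ k μ, N k ∘ₗ bgrad η⁻¹ (liftEquiv (τ μ) ι) ∘ₗ mulOp (fun p : X × ι => χX k p.1) = Tb k μ ∘ₗ mulOp (fun p : X × ι => χX k p.1))
    (hTfr : ∀ k μ, HasMaj (BlockNorm.ofBlocks g (liftBlk blk ι)) (BlockNorm.ofBlocks g (liftBlk blk ι)) (Tf k μ) (fun y y' => ind (Sk k) y * ind (Sk k) y' * (βQ * Real.exp (-(δ * g.dist y y')))))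
    (hTbr : ∀ k μ, HasMaj (BlockNorm.ofBlocks g (liftBlk blk ι)) (BlockNorm.ofBlocks g (liftBlk blk ι)) (Tb k μ) (fun y y' => ind (Sk k) y * ind (Sk k) y' * (βQ * Real.exp (-(δ * g.dist y y')))))
    (hTfψ : ∀ k μ, Tf k μ ∘ₗ mulOp (fun p : X × ι => ψ₂X k p.1) = Tf k μ) (hTbψ : ∀ k μ, Tb k μ ∘ₗ mulOp (fun p : X × ι => ψ₂X k p.1) = Tb k μ)
    (hflat0 : ∀ k, (mulOp (fun p : X × ι => χtX k p.1) ∘ₗ N k) ∘ₗ (lapOp η⁻¹ (fun μ => liftEquiv (τ μ) ι) 0 + NL) ∘ₗ mulOp (fun p : X × ι => hX k p.1) = mulOp (fun p : X × ι => hX k p.1))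
    -- per cube: the partition (`|h| ≤ 1`, `Σh² = 1`, letters `c₀, c₁, c₂`, block reading `ℓ, ω`), its supports inside `χ_k`, `ψ_k`, `χ̃_k` (with shifts and quotients), transition layers; overlap
    (hhabs : ∀ k x, |hX k x| ≤ 1) (h236 : ∀ p : X × ι, ∑ k, (fun p : X × ι => hX k p.1) p ^ 2 = 1)
    (hhcut : ∀ k, mulOp (fun p : X × ι => hX k p.1) ∘ₗ mulOp (fun p : X × ι => χX k p.1) = mulOp (fun p : X × ι => hX k p.1))
    (hh1 : ∀ k μ x, |fgrad η⁻¹ (τ μ) (hX k) x| ≤ c₁) (hh1b : ∀ k μ x, |bgrad η⁻¹ (τ μ) (hX k) x| ≤ c₁) (hh0 : ∀ k μ x, |hX k (τ μ x) - hX k x| ≤ c₀)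
    (hLip : ∀ k y y', |hb k y - hb k y'| ≤ ℓ * g.dist y y') (hrh : ∀ k x, |hX k x - hb k (blk x)| ≤ ω)
    (hh2 : ∀ k μ p, |fgradAdj η⁻¹ (liftEquiv (τ μ) ι) (fgrad η⁻¹ (liftEquiv (τ μ) ι) (fun p : X × ι => hX k p.1)) p| ≤ c₂)
    (hh2f : ∀ k μ p, |fgrad η⁻¹ (liftEquiv (τ μ) ι) (fgrad η⁻¹ (liftEquiv (τ μ) ι) (fun p : X × ι => hX k p.1)) p| ≤ c₂)
    (hh2b : ∀ k μ p, |bgrad η⁻¹ (liftEquiv (τ μ) ι) (bgrad η⁻¹ (liftEquiv (τ μ) ι) (fun p : X × ι => hX k p.1) ∘ ⇑(liftEquiv (τ μ) ι)) p| ≤ c₂)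
    (hlayf : ∀ k μ x, hX k x ≠ hX k ((τ μ).symm x) → χX k x = 1) (hlayb : ∀ k μ x, hX k (τ μ x) ≠ hX k x → χX k x = 1) (hlayν : ∀ k x, hX k (τ ν x) ≠ 0 → χX k x = 1)
    (hhψ : ∀ k, mulOp (fun p : X × ι => hX k p.1) ∘ₗ mulOp (fun p : X × ι => ψX k p.1) = mulOp (fun p : X × ι => hX k p.1))
    (hχth : ∀ k, mulOp (fun p : X × ι => χtX k p.1) ∘ₗ mulOp (fun p : X × ι => hX k p.1) = mulOp (fun p : X × ι => hX k p.1))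
    (hhts' : ∀ k μ, mulOp (fun p : X × ι => χtX k p.1) ∘ₗ mulOp ((fun p : X × ι => hX k p.1) ∘ (liftEquiv (τ μ) ι)) = mulOp ((fun p : X × ι => hX k p.1) ∘ (liftEquiv (τ μ) ι)))
    (hhtsb' : ∀ k μ, mulOp (fun p : X × ι => χtX k p.1) ∘ₗ mulOp ((fun p : X × ι => hX k p.1) ∘ (liftEquiv (τ μ) ι).symm) = mulOp ((fun p : X × ι => hX k p.1) ∘ (liftEquiv (τ μ) ι).symm))
    (hhtdd' : ∀ k μ, mulOp (fun p : X × ι => χtX k p.1) ∘ₗ mulOp (fgrad η⁻¹ (liftEquiv (τ μ) ι) (fun p : X × ι => hX k p.1)) = mulOp (fgrad η⁻¹ (liftEquiv (τ μ) ι) (fun p : X × ι => hX k p.1)))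
    (hhtddb' : ∀ k μ, mulOp (fun p : X × ι => χtX k p.1) ∘ₗ mulOp (bgrad η⁻¹ (liftEquiv (τ μ) ι) (fun p : X × ι => hX k p.1)) = mulOp (bgrad η⁻¹ (liftEquiv (τ μ) ι) (fun p : X × ι => hX k p.1)))
    (hN : ∀ a, ∑ k, ind (Sk k) a ≤ Nov)
    (hKN : ∀ k, HasMaj (BlockNorm.ofBlocks g (liftBlk blk ι)) (BlockNorm.ofBlocks g (liftBlk blk ι)) (commOp NL (fun p : X × ι => hX k p.1)) (fun y y' => cN * Real.exp (-(ρN * g.dist y y'))))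
    -- THE GAUGE GROUP OF RECORD: trace-form coordinates `e` of `𝔤 = 𝔲(m)`, unitary per-cube site gauges `u_k`, unitary bond variables `U`, Bałaban's nonlocal summand `P` read in cube `k`'s
    -- gauge as `N_L − N_V k`; the species of the transformed bond variables AND THE QUOTIENTS OF ITS FIRST-ORDER PART small where `χ_k ≠ 0` ((3.35) on the cube); letters of `N_V k`
    (he : ∀ A B : Matrix m m ℂ, traceForm A B = e A ⬝ᵥ e B) (hu : ∀ k x, (u k x)ᴴ * u k x = 1) {rV rD RN θF ρF : ℝ} (hrV : 0 ≤ rV) (hrD : 0 ≤ rD) (hRN : 0 ≤ RN) (hθF : 0 ≤ θF)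
    (hρF : ρ₃ ≤ ρF) (hRle : rV * (1 + Fintype.card (J ⊕ J)) + RN ≤ R)
    (hP : ∀ k, mmulOp (fun x => coordMat e (ContinuousLinearMap.mulLeftRight ℝ (Matrix m m ℂ) (u k x) (u k x)ᴴ)) ∘ₗ P ∘ₗ mmulOp (fun x => (coordMat e (ContinuousLinearMap.mulLeftRight ℝ (Matrix m m ℂ) (u k x) (u k x)ᴴ))ᵀ) = NL - NV k)
    (hCloc : ∀ k x, χX k x ≠ 0 → ∀ i, ∑ j, |(tCoefC η (gaugePair τ fun μ x => coordMat e (ContinuousLinearMap.mulLeftRight ℝ (Matrix m m ℂ) (u k x * U μ x * (u k (τ μ x))ᴴ) (u k x * U μ x * (u k (τ μ x))ᴴ)ᴴ))) x i j| ≤ rV)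
    (hAloc : ∀ k j' x, χX k x ≠ 0 → ∀ i, ∑ j, |(tCoefA η (gaugePair τ fun μ x => coordMat e (ContinuousLinearMap.mulLeftRight ℝ (Matrix m m ℂ) (u k x * U μ x * (u k (τ μ x))ᴴ) (u k x * U μ x * (u k (τ μ x))ᴴ)ᴴ))) j' x i j| ≤ rV)
    (hDAf : ∀ k μ x, χX k x ≠ 0 → ∀ i, ∑ j, |fgradMat η⁻¹ (τ μ) ((tCoefA η (gaugePair τ fun μ x => coordMat e (ContinuousLinearMap.mulLeftRight ℝ (Matrix m m ℂ) (u k x * U μ x * (u k (τ μ x))ᴴ) (u k x * U μ x * (u k (τ μ x))ᴴ)ᴴ))) (Sum.inl μ)) x i j| ≤ rD)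
    (hDAb : ∀ k μ x, χX k x ≠ 0 → ∀ i, ∑ j, |fgradMat η⁻¹ (τ μ) ((tCoefA η (gaugePair τ fun μ x => coordMat e (ContinuousLinearMap.mulLeftRight ℝ (Matrix m m ℂ) (u k x * U μ x * (u k (τ μ x))ᴴ) (u k x * U μ x * (u k (τ μ x))ᴴ)ᴴ))) (Sum.inr μ)) x i j| ≤ rD)
    (hNVcut : ∀ k, HasMaj (BlockNorm.ofBlocks g (liftBlk blk ι)) (BlockNorm.ofBlocks g (liftBlk blk ι)) (mulOp (fun p : X × ι => ψX k p.1) ∘ₗ NV k ∘ₗ mulOp (fun p : X × ι => χX k p.1)) (fun y y' => RN * Real.exp (-(δV * g.dist y y'))))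
    (hfarN : ∀ k, HasMaj (BlockNorm.ofBlocks g (liftBlk blk ι)) (BlockNorm.ofBlocks g (liftBlk blk ι)) (mulOp (fun p : X × ι => hX k p.1) ∘ₗ NV k ∘ₗ (LinearMap.id - mulOp (fun p : X × ι => χtX k p.1))) (fun y y' => θF * Real.exp (-(ρF * g.dist y y'))))
    -- THE RIGHT FACTOR `E`: its scalar adjoint Leibniz rule through the partition and its PER-CUBE COVARIANT SHAPE in the gauge `u_k`, with coefficient rows
    {E : (X × ι → ℝ) →ₗ[ℝ] (X × ι → ℝ)} {RE BE : K → X → Matrix ι ι ℝ} {dh : K → X → ℝ} {rR rR' rB : ℝ} (hrR : 0 ≤ rR) (hrR' : 0 ≤ rR') (hrB : 0 ≤ rB)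
    (hleib : ∀ k, mulOp (fun p : X × ι => hX k p.1) ∘ₗ E = E ∘ₗ mulOp (fun p : X × ι => hX k (τ ν p.1)) + mulOp (fun p : X × ι => dh k p.1)) (hdh : ∀ k x, |dh k x| ≤ c₁)
    (hEcov : ∀ k, mmulOp (fun x => coordMat e (ContinuousLinearMap.mulLeftRight ℝ (Matrix m m ℂ) (u k x) (u k x)ᴴ)) ∘ₗ E ∘ₗ mmulOp (fun x => (coordMat e (ContinuousLinearMap.mulLeftRight ℝ (Matrix m m ℂ) (u k x) (u k x)ᴴ))ᵀ) = mmulOp (RE k) ∘ₗ bgrad η⁻¹ (liftEquiv (τ ν) ι) + mmulOp (BE k))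
    (hRE : ∀ k x i, ∑ j, |(RE k ∘ ⇑(τ ν)) x i j| ≤ rR) (hRE' : ∀ k x i, ∑ j, |(fgradMat η⁻¹ (τ ν) (RE k)) x i j| ≤ rR') (hBE : ∀ k x i, ∑ j, |BE k x i j| ≤ rB)
    (hqA : (β * rV + Fintype.card J * (2 * (βQ * rV + β * (rD + ct * rV))) + β * RN * cr) * cr < 1)
    (hqL : Nov * ((Fintype.card ι : ℝ) ^ 2 * ((((((Fintype.card J : ℝ) * (3 * ((β + (β₁ + ct * β)) * (1 - (β + (β₁ + ct * β)) * (R * cr) * cr)⁻¹ * c₂) + 2 * (((1 - (β * rV + Fintype.card J * (2 * (βQ * rV + β * (rD + ct * rV))) + β * RN * cr) * cr)⁻¹ * βQ * cr) * c₁)) + 0)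
          + (β + (β₁ + ct * β)) * (1 - (β + (β₁ + ct * β)) * (R * cr) * cr)⁻¹ * cN * cr)
        + (((Fintype.card J : ℝ) * (2 * rV * (c₁ * ((β + (β₁ + ct * β)) * (1 - (β + (β₁ + ct * β)) * (R * cr) * cr)⁻¹) + c₀ * ((1 - (β * rV + Fintype.card J * (2 * (βQ * rV + β * (rD + ct * rV))) + β * RN * cr) * cr)⁻¹ * βQ * cr))))
          + (β + (β₁ + ct * β)) * (1 - (β + (β₁ + ct * β)) * (R * cr) * cr)⁻¹ * ((ℓ * (Real.exp 1 * ε)⁻¹ + 2 * ω) * RN) * cr))) + (((β + (β₁ + ct * β)) * (1 - (β + (β₁ + ct * β)) * (R * cr) * cr)⁻¹) * θF * cr)) + (Fintype.card ι : ℝ) ^ 2 * 0) * cr < 1)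
    (hq : (β + (β₁ + ct * β)) * (R * cr) * cr < 1) {Yop : (X × ι → ℝ) →ₗ[ℝ] (X × ι → ℝ)} (hY : (covLapM τ η (gaugePair τ (fun μ x => coordMat e (ContinuousLinearMap.mulLeftRight ℝ (Matrix m m ℂ) (U μ x) (U μ x)ᴴ))) + P) ∘ₗ Yop = LinearMap.id) :
    HasMaj (BlockNorm.ofBlocks g (liftBlk blk ι)) (BlockNorm.ofBlocks g (liftBlk blk ι)) (Yop ∘ₗ E)
      (fun y y' => (1 - Nov * ((Fintype.card ι : ℝ) ^ 2 * ((((((Fintype.card J : ℝ) * (3 * ((β + (β₁ + ct * β)) * (1 - (β + (β₁ + ct * β)) * (R * cr) * cr)⁻¹ * c₂) + 2 * (((1 - (β * rV + Fintype.card J * (2 * (βQ * rV + β * (rD + ct * rV))) + β * RN * cr) * cr)⁻¹ * βQ * cr) * c₁)) + 0)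
          + (β + (β₁ + ct * β)) * (1 - (β + (β₁ + ct * β)) * (R * cr) * cr)⁻¹ * cN * cr)
        + (((Fintype.card J : ℝ) * (2 * rV * (c₁ * ((β + (β₁ + ct * β)) * (1 - (β + (β₁ + ct * β)) * (R * cr) * cr)⁻¹) + c₀ * ((1 - (β * rV + Fintype.card J * (2 * (βQ * rV + β * (rD + ct * rV))) + β * RN * cr) * cr)⁻¹ * βQ * cr))))
          + (β + (β₁ + ct * β)) * (1 - (β + (β₁ + ct * β)) * (R * cr) * cr)⁻¹ * ((ℓ * (Real.exp 1 * ε)⁻¹ + 2 * ω) * RN) * cr))) + (((β + (β₁ + ct * β)) * (1 - (β + (β₁ + ct * β)) * (R * cr) * cr)⁻¹) * θF * cr)) + (Fintype.card ι : ℝ) ^ 2 * 0) * cr)⁻¹ * (Nov * ((Fintype.card ι : ℝ) ^ 2 * (((1 - (β * rV + Fintype.card J * (2 * (βQ * rV + β * (rD + ct * rV))) + β * RN * cr) * cr)⁻¹ * βQ * cr) * rR + ((β + (β₁ + ct * β)) * (1 - (β + (β₁ + ct * β)) * (R * cr) * cr)⁻¹) * rR' + ((β + (β₁ + ct * β)) *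 (1 - (β + (β₁ + ct * β)) * (R * cr) * cr)⁻¹) * rB) * 1 + (Fintype.card ι : ℝ) ^ 2 * ((β + (β₁ + ct * β)) * (1 - (β + (β₁ + ct * β)) * (R * cr) * cr)⁻¹) * c₁)) * cr *
        Real.exp (-((ρ₃ - 2 * σ) * g.dist y y'))) := by
  obtain ⟨hI, hII, -⟩ := uN_gluedL_smoothCutDressed_localGauges_cov_spec blk τ ν e η htri hd hd0 hsymm hrow hσ hβ hβ₁ hβQ hct hR hcr hNov hc₀ hc₁ hc₂ hcN hℓ hω hε hσρ hρ₁V hρ₁G hρ₂ hρ₂₁ hρ₃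
    hρ₃₂ hρ₃V hρ₃N hσρ₃ hSχ hSψ hSψ₂ hχt hχ1 hdχt hdχtb hsub hχ hs hsb hdd hddb hNψ hψχ hcut hcutF hcutB hTf hTb hTfr hTbr hTfψ hTbψ hflat0 hhabs h236 hhcut hh1 hh1b hh0 hLip hrh hh2
    hh2f hh2b hlayf hlayb hlayν hhψ hχth hhts' hhtsb' hhtdd' hhtddb' hN hKN he hu hrV hrD hRN hθF hρF hRle hP hCloc hAloc hDAf hDAb hNVcut hfarN hrR hrR' hrB hleib hdh hEcov hRE hRE'
    hBE hqA hqL hq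
  have hEq : Yop = glueInvL (remainderL (covLapM τ η (gaugePair τ (fun μ x => coordMat e (ContinuousLinearMap.mulLeftRight ℝ (Matrix m m ℂ) (U μ x) (U μ x)ᴴ))) + P) (fun k => fun p : X × ι => hX k p.1) (fun k => (mmulOp (fun x => (coordMat e (ContinuousLinearMap.mulLeftRight ℝ (Matrix m m ℂ) (u k x) (u k x)ᴴ))ᵀ) ∘ₗ (projO none ∘ₗ bgPropV (stack (mulOp (fun p : X × ι => χtX k p.1) ∘ₗ N k) (fun j => Sum.elim (fun μ => fgrad η⁻¹ (liftEquiv (τ μ) ι)) (fun μ => bgrad η⁻¹ (liftEquiv (τ μ) ι)) j ∘ₗ (mulOp (fun p : X × ι => χtX k p.1) ∘ₗ N k))) (unstackM (fun x => χtX k x • (tCoefC η (gaugePair τ fun μ x => coordMat e (ContinuousLinearMap.mulLeftRight ℝ (Matrix m m ℂ) (u k x * U μ x * (u k (τ μ x))ᴴ) (u k x * U μ x * (u k (τ μ x))ᴴ)ᴴ))) x) (fun μ x => χtX k x • (tCoefA η (gaugePair τ fun μ x => coordMat e (ContinuousLinearMap.mulLeftRight ℝ (Matrix m m ℂ) (u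 k x * U μ x * (u k (τ μ x))ᴴ) (u k x * U μ x * (u k (τ μ x))ᴴ)ᴴ))) μ x) + (mulOp (fun p : X × ι => ψX k p.1) ∘ₗ NV k ∘ₗ mulOp (fun p : X × ι => χtX k p.1)) ∘ₗ projO (none : Option (J ⊕ J)))) ∘ₗ mmulOp (fun x => coordMat e (ContinuousLinearMap.mulLeftRight ℝ (Matrix m m ℂ) (u k x) (u k x)ᴴ)))) -
          ∑ k, mulOp (fun p : X × ι => hX k p.1) ∘ₗ (mmulOp (fun x => (coordMat e (ContinuousLinearMap.mulLeftRight ℝ (Matrix m m ℂ) (u k x) (u k x)ᴴ))ᵀ) ∘ₗ ((projO none ∘ₗ bgPropV (stack (mulOp (fun p : X × ι => χtX k p.1) ∘ₗ N k) (fun j => Sum.elim (fun μ => fgrad η⁻¹ (liftEquiv (τ μ) ι)) (fun μ => bgrad η⁻¹ (liftEquiv (τ μ) ι)) j ∘ₗ (mulOp (fun p : X × ι => χtX k p.1) ∘ₗ N k))) (unstackM (fun x => χtX k x • (tCoefC η (gaugePair τ fun μ x => coordMat e (ContinuousLinearMap.mulLeftRight ℝ (Matrix m m ℂ) (u k x *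 U μ x * (u k (τ μ x))ᴴ) (u k x * U μ x * (u k (τ μ x))ᴴ)ᴴ))) x) (fun μ x => χtX k x • (tCoefA η (gaugePair τ fun μ x => coordMat e (ContinuousLinearMap.mulLeftRight ℝ (Matrix m m ℂ) (u k x * U μ x * (u k (τ μ x))ᴴ) (u k x * U μ x * (u k (τ μ x))ᴴ)ᴴ))) μ x) + (mulOp (fun p : X × ι => ψX k p.1) ∘ₗ NV k ∘ₗ mulOp (fun p : X × ι => χtX k p.1)) ∘ₗ projO (none : Option (J ⊕ J)))) ∘ₗ (-(((unstackM (tCoefC η (gaugePair τ fun μ x => coordMat e (ContinuousLinearMap.mulLeftRight ℝ (Matrix m m ℂ) (u k x * U μ x * (u k (τ μ x))ᴴ) (u k x * U μ x * (u k (τ μ x))ᴴ)ᴴ))) (tCoefA η (gaugePair τ fun μ x => coordMat e (ContinuousLinearMap.mulLeftRight ℝ (Matrix m m ℂ) (u k x * U μ x * (u k (τ μ x))ᴴ) (u k x * U μ x * (u k (τ μ x))ᴴ)ᴴ))) + NV k ∘ₗ projO none) - mulOp (fun p : X × ι => ψX k p.1) ∘ₗ (unstackM (tCoefC η (gaugePair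 τ fun μ x => coordMat e (ContinuousLinearMap.mulLeftRight ℝ (Matrix m m ℂ) (u k x * U μ x * (u k (τ μ x))ᴴ) (u k x * U μ x * (u k (τ μ x))ᴴ)ᴴ))) (tCoefA η (gaugePair τ fun μ x => coordMat e (ContinuousLinearMap.mulLeftRight ℝ (Matrix m m ℂ) (u k x * U μ x * (u k (τ μ x))ᴴ) (u k x * U μ x * (u k (τ μ x))ᴴ)ᴴ))) + NV k ∘ₗ projO none) ∘ₗ mulOp (fun q : (X × ι) × Option (J ⊕ J) => χtX k q.1.1)) ∘ₗ stack LinearMap.id (fun j => Sum.elim (fun μ => fgrad η⁻¹ (liftEquiv (τ μ) ι)) (fun μ => bgrad η⁻¹ (liftEquiv (τ μ) ι)) j))) ∘ₗ mulOp (fun p : X × ι => hX k p.1)) ∘ₗ mmulOp (fun x => coordMat e (ContinuousLinearMap.mulLeftRight ℝ (Matrix m m ℂ) (u k x) (u k x)ᴴ))))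
        (parametrix (fun k => fun p : X × ι => hX k p.1) (fun k => (mmulOp (fun x => (coordMat e (ContinuousLinearMap.mulLeftRight ℝ (Matrix m m ℂ) (u k x) (u k x)ᴴ))ᵀ) ∘ₗ (projO none ∘ₗ bgPropV (stack (mulOp (fun p : X × ι => χtX k p.1) ∘ₗ N k) (fun j => Sum.elim (fun μ => fgrad η⁻¹ (liftEquiv (τ μ) ι)) (fun μ => bgrad η⁻¹ (liftEquiv (τ μ) ι)) j ∘ₗ (mulOp (fun p : X × ι => χtX k p.1) ∘ₗ N k))) (unstackM (fun x => χtX k x • (tCoefC η (gaugePair τ fun μ x => coordMat e (ContinuousLinearMap.mulLeftRight ℝ (Matrix m m ℂ) (u k x * U μ x * (u k (τ μ x))ᴴ) (u k x * U μ x * (u k (τ μ x))ᴴ)ᴴ))) x) (fun μ x => χtX k x • (tCoefA η (gaugePair τ fun μ x => coordMat e (ContinuousLinearMap.mulLeftRight ℝ (Matrix m m ℂ) (u k x * U μ x * (u k (τ μ x))ᴴ) (u k x * U μ x * (u k (τ μ x))ᴴ)ᴴ))) μ x) + (mulOp (fun p : X × ι => ψX k p.1) ∘ₗ NV k ∘ₗ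 mulOp (fun p : X × ι => χtX k p.1)) ∘ₗ projO (none : Option (J ⊕ J)))) ∘ₗ mmulOp (fun x => coordMat e (ContinuousLinearMap.mulLeftRight ℝ (Matrix m m ℂ) (u k x) (u k x)ᴴ))))) := by
    calc Yop = (glueInvL (remainderL (covLapM τ η (gaugePair τ (fun μ x => coordMat e (ContinuousLinearMap.mulLeftRight ℝ (Matrix m m ℂ) (U μ x) (U μ x)ᴴ))) + P) (fun k => fun p : X × ι => hX k p.1) (fun k => (mmulOp (fun x => (coordMat e (ContinuousLinearMap.mulLeftRight ℝ (Matrix m m ℂ) (u k x) (u k x)ᴴ))ᵀ) ∘ₗ (projO none ∘ₗ bgPropV (stack (mulOp (fun p : X × ι => χtX k p.1) ∘ₗ N k) (fun j => Sum.elim (fun μ => fgrad η⁻¹ (liftEquiv (τ μ) ι)) (fun μ => bgrad η⁻¹ (liftEquiv (τ μ) ι)) j ∘ₗ (mulOp (fun p : X × ι => χtX k p.1) ∘ₗ N k))) (unstackM (fun x => χtX k x • (tCoefC η (gaugePair τ fun μ x => coordMat e (ContinuousLinearMap.mulLeftRight ℝ (Matrix m m ℂ) (u k x * U μ x * (u k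 (τ μ x))ᴴ) (u k x * U μ x * (u k (τ μ x))ᴴ)ᴴ))) x) (fun μ x => χtX k x • (tCoefA η (gaugePair τ fun μ x => coordMat e (ContinuousLinearMap.mulLeftRight ℝ (Matrix m m ℂ) (u k x * U μ x * (u k (τ μ x))ᴴ) (u k x * U μ x * (u k (τ μ x))ᴴ)ᴴ))) μ x) + (mulOp (fun p : X × ι => ψX k p.1) ∘ₗ NV k ∘ₗ mulOp (fun p : X × ι => χtX k p.1)) ∘ₗ projO (none : Option (J ⊕ J)))) ∘ₗ mmulOp (fun x => coordMat e (ContinuousLinearMap.mulLeftRight ℝ (Matrix m m ℂ) (u k x) (u k x)ᴴ)))) -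
          ∑ k, mulOp (fun p : X × ι => hX k p.1) ∘ₗ (mmulOp (fun x => (coordMat e (ContinuousLinearMap.mulLeftRight ℝ (Matrix m m ℂ) (u k x) (u k x)ᴴ))ᵀ) ∘ₗ ((projO none ∘ₗ bgPropV (stack (mulOp (fun p : X × ι => χtX k p.1) ∘ₗ N k) (fun j => Sum.elim (fun μ => fgrad η⁻¹ (liftEquiv (τ μ) ι)) (fun μ => bgrad η⁻¹ (liftEquiv (τ μ) ι)) j ∘ₗ (mulOp (fun p : X × ι => χtX k p.1) ∘ₗ N k))) (unstackM (fun x => χtX k x • (tCoefC η (gaugePair τ fun μ x => coordMat e (ContinuousLinearMap.mulLeftRight ℝ (Matrix m m ℂ) (u k x * U μ x * (u k (τ μ x))ᴴ) (u k x * U μ x * (u k (τ μ x))ᴴ)ᴴ))) x) (fun μ x => χtX k x • (tCoefA η (gaugePair τ fun μ x => coordMat e (ContinuousLinearMap.mulLeftRight ℝ (Matrix m m ℂ) (u k x * U μ x * (u k (τ μ x))ᴴ) (u k x * U μ x * (u k (τ μ x))ᴴ)ᴴ))) μ x) + (mulOp (fun p : X × ι => ψX k p.1) ∘ₗ NV k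 ∘ₗ mulOp (fun p : X × ι => χtX k p.1)) ∘ₗ projO (none : Option (J ⊕ J)))) ∘ₗ (-(((unstackM (tCoefC η (gaugePair τ fun μ x => coordMat e (ContinuousLinearMap.mulLeftRight ℝ (Matrix m m ℂ) (u k x * U μ x * (u k (τ μ x))ᴴ) (u k x * U μ x * (u k (τ μ x))ᴴ)ᴴ))) (tCoefA η (gaugePair τ fun μ x => coordMat e (ContinuousLinearMap.mulLeftRight ℝ (Matrix m m ℂ) (u k x * U μ x * (u k (τ μ x))ᴴ) (u k x * U μ x * (u k (τ μ x))ᴴ)ᴴ))) + NV k ∘ₗ projO none) - mulOp (fun p : X × ι => ψX k p.1) ∘ₗ (unstackM (tCoefC η (gaugePair τ fun μ x => coordMat e (ContinuousLinearMap.mulLeftRight ℝ (Matrix m m ℂ) (u k x * U μ x * (u k (τ μ x))ᴴ) (u k x * U μ x * (u k (τ μ x))ᴴ)ᴴ))) (tCoefA η (gaugePair τ fun μ x => coordMat e (ContinuousLinearMap.mulLeftRight ℝ (Matrix m m ℂ) (u k x * U μ x * (u k (τ μ x))ᴴ) (u k x * U μ x * (u k (τ μ x))ᴴ)ᴴ)))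 + NV k ∘ₗ projO none) ∘ₗ mulOp (fun q : (X × ι) × Option (J ⊕ J) => χtX k q.1.1)) ∘ₗ stack LinearMap.id (fun j => Sum.elim (fun μ => fgrad η⁻¹ (liftEquiv (τ μ) ι)) (fun μ => bgrad η⁻¹ (liftEquiv (τ μ) ι)) j))) ∘ₗ mulOp (fun p : X × ι => hX k p.1)) ∘ₗ mmulOp (fun x => coordMat e (ContinuousLinearMap.mulLeftRight ℝ (Matrix m m ℂ) (u k x) (u k x)ᴴ))))
        (parametrix (fun k => fun p : X × ι => hX k p.1) (fun k => (mmulOp (fun x => (coordMat e (ContinuousLinearMap.mulLeftRight ℝ (Matrix m m ℂ) (u k x) (u k x)ᴴ))ᵀ) ∘ₗ (projO none ∘ₗ bgPropV (stack (mulOp (fun p : X × ι => χtX k p.1) ∘ₗ N k) (fun j => Sum.elim (fun μ => fgrad η⁻¹ (liftEquiv (τ μ) ι)) (fun μ => bgrad η⁻¹ (liftEquiv (τ μ) ι)) j ∘ₗ (mulOp (fun p : X × ι => χtX k p.1) ∘ₗ N k))) (unstackM (fun x => χtX k x • (tCoefC η (gaugePair τ fun μ x => coordMat e (ContinuousLinearMap.mulLeftRight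 ℝ (Matrix m m ℂ) (u k x * U μ x * (u k (τ μ x))ᴴ) (u k x * U μ x * (u k (τ μ x))ᴴ)ᴴ))) x) (fun μ x => χtX k x • (tCoefA η (gaugePair τ fun μ x => coordMat e (ContinuousLinearMap.mulLeftRight ℝ (Matrix m m ℂ) (u k x * U μ x * (u k (τ μ x))ᴴ) (u k x * U μ x * (u k (τ μ x))ᴴ)ᴴ))) μ x) + (mulOp (fun p : X × ι => ψX k p.1) ∘ₗ NV k ∘ₗ mulOp (fun p : X × ι => χtX k p.1)) ∘ₗ projO (none : Option (J ⊕ J)))) ∘ₗ mmulOp (fun x => coordMat e (ContinuousLinearMap.mulLeftRight ℝ (Matrix m m ℂ) (u k x) (u k x)ᴴ))))) ∘ₗ (covLapM τ η (gaugePair τ (fun μ x => coordMat e (ContinuousLinearMap.mulLeftRight ℝ (Matrix m m ℂ) (U μ x) (U μ x)ᴴ))) + P)) ∘ₗ Yop := by rw [hII, LinearMap.id_comp]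
      _ = glueInvL (remainderL (covLapM τ η (gaugePair τ (fun μ x => coordMat e (ContinuousLinearMap.mulLeftRight ℝ (Matrix m m ℂ) (U μ x) (U μ x)ᴴ))) + P) (fun k => fun p : X × ι => hX k p.1) (fun k => (mmulOp (fun x => (coordMat e (ContinuousLinearMap.mulLeftRight ℝ (Matrix m m ℂ) (u k x) (u k x)ᴴ))ᵀ) ∘ₗ (projO none ∘ₗ bgPropV (stack (mulOp (fun p : X × ι => χtX k p.1) ∘ₗ N k) (fun j => Sum.elim (fun μ => fgrad η⁻¹ (liftEquiv (τ μ) ι)) (fun μ => bgrad η⁻¹ (liftEquiv (τ μ) ι)) j ∘ₗ (mulOp (fun p : X × ι => χtX k p.1) ∘ₗ N k))) (unstackM (fun x => χtX k x • (tCoefC η (gaugePair τ fun μ x => coordMat e (ContinuousLinearMap.mulLeftRight ℝ (Matrix m m ℂ) (u k x * U μ x * (u k (τ μ x))ᴴ) (u k x * U μ x * (u k (τ μ x))ᴴ)ᴴ))) x) (fun μ x => χtX k x • (tCoefA η (gaugePair τ fun μ x => coordMat e (ContinuousLinearMap.mulLeftRight ℝ (Matrix m m ℂ) (u k x * U μ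 x * (u k (τ μ x))ᴴ) (u k x * U μ x * (u k (τ μ x))ᴴ)ᴴ))) μ x) + (mulOp (fun p : X × ι => ψX k p.1) ∘ₗ NV k ∘ₗ mulOp (fun p : X × ι => χtX k p.1)) ∘ₗ projO (none : Option (J ⊕ J)))) ∘ₗ mmulOp (fun x => coordMat e (ContinuousLinearMap.mulLeftRight ℝ (Matrix m m ℂ) (u k x) (u k x)ᴴ)))) -
          ∑ k, mulOp (fun p : X × ι => hX k p.1) ∘ₗ (mmulOp (fun x => (coordMat e (ContinuousLinearMap.mulLeftRight ℝ (Matrix m m ℂ) (u k x) (u k x)ᴴ))ᵀ) ∘ₗ ((projO none ∘ₗ bgPropV (stack (mulOp (fun p : X × ι => χtX k p.1) ∘ₗ N k) (fun j => Sum.elim (fun μ => fgrad η⁻¹ (liftEquiv (τ μ) ι)) (fun μ => bgrad η⁻¹ (liftEquiv (τ μ) ι)) j ∘ₗ (mulOp (fun p : X × ι => χtX k p.1) ∘ₗ N k))) (unstackM (fun x => χtX k x • (tCoefC η (gaugePair τ fun μ x => coordMat e (ContinuousLinearMap.mulLeftRight ℝ (Matrix m m ℂ) (u k x * U μ x * (u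 k (τ μ x))ᴴ) (u k x * U μ x * (u k (τ μ x))ᴴ)ᴴ))) x) (fun μ x => χtX k x • (tCoefA η (gaugePair τ fun μ x => coordMat e (ContinuousLinearMap.mulLeftRight ℝ (Matrix m m ℂ) (u k x * U μ x * (u k (τ μ x))ᴴ) (u k x * U μ x * (u k (τ μ x))ᴴ)ᴴ))) μ x) + (mulOp (fun p : X × ι => ψX k p.1) ∘ₗ NV k ∘ₗ mulOp (fun p : X × ι => χtX k p.1)) ∘ₗ projO (none : Option (J ⊕ J)))) ∘ₗ (-(((unstackM (tCoefC η (gaugePair τ fun μ x => coordMat e (ContinuousLinearMap.mulLeftRight ℝ (Matrix m m ℂ) (u k x * U μ x * (u k (τ μ x))ᴴ) (u k x * U μ x * (u k (τ μ x))ᴴ)ᴴ))) (tCoefA η (gaugePair τ fun μ x => coordMat e (ContinuousLinearMap.mulLeftRight ℝ (Matrix m m ℂ) (u k x * U μ x * (u k (τ μ x))ᴴ) (u k x * U μ x * (u k (τ μ x))ᴴ)ᴴ))) + NV k ∘ₗ projO none) - mulOp (fun p : X × ι => ψX k p.1) ∘ₗ (unstackM (tCoefC η (gaugePair τ fun μ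 x => coordMat e (ContinuousLinearMap.mulLeftRight ℝ (Matrix m m ℂ) (u k x * U μ x * (u k (τ μ x))ᴴ) (u k x * U μ x * (u k (τ μ x))ᴴ)ᴴ))) (tCoefA η (gaugePair τ fun μ x => coordMat e (ContinuousLinearMap.mulLeftRight ℝ (Matrix m m ℂ) (u k x * U μ x * (u k (τ μ x))ᴴ) (u k x * U μ x * (u k (τ μ x))ᴴ)ᴴ))) + NV k ∘ₗ projO none) ∘ₗ mulOp (fun q : (X × ι) × Option (J ⊕ J) => χtX k q.1.1)) ∘ₗ stack LinearMap.id (fun j => Sum.elim (fun μ => fgrad η⁻¹ (liftEquiv (τ μ) ι)) (fun μ => bgrad η⁻¹ (liftEquiv (τ μ) ι)) j))) ∘ₗ mulOp (fun p : X × ι => hX k p.1)) ∘ₗ mmulOp (fun x => coordMat e (ContinuousLinearMap.mulLeftRight ℝ (Matrix m m ℂ) (u k x) (u k x)ᴴ))))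
        (parametrix (fun k => fun p : X × ι => hX k p.1) (fun k => (mmulOp (fun x => (coordMat e (ContinuousLinearMap.mulLeftRight ℝ (Matrix m m ℂ) (u k x) (u k x)ᴴ))ᵀ) ∘ₗ (projO none ∘ₗ bgPropV (stack (mulOp (fun p : X × ι => χtX k p.1) ∘ₗ N k) (fun j => Sum.elim (fun μ => fgrad η⁻¹ (liftEquiv (τ μ) ι)) (fun μ => bgrad η⁻¹ (liftEquiv (τ μ) ι)) j ∘ₗ (mulOp (fun p : X × ι => χtX k p.1) ∘ₗ N k))) (unstackM (fun x => χtX k x • (tCoefC η (gaugePair τ fun μ x => coordMat e (ContinuousLinearMap.mulLeftRight ℝ (Matrix m m ℂ) (u k x * U μ x * (u k (τ μ x))ᴴ) (u k x * U μ x * (u k (τ μ x))ᴴ)ᴴ))) x) (fun μ x => χtX k x • (tCoefA η (gaugePair τ fun μ x => coordMat e (ContinuousLinearMap.mulLeftRight ℝ (Matrix m m ℂ) (u k x * U μ x * (u k (τ μ x))ᴴ) (u k x * U μ x * (u k (τ μ x))ᴴ)ᴴ))) μ x) + (mulOp (fun p : X × ι => ψX k p.1) ∘ₗ NV k ∘ₗ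 mulOp (fun p : X × ι => χtX k p.1)) ∘ₗ projO (none : Option (J ⊕ J)))) ∘ₗ mmulOp (fun x => coordMat e (ContinuousLinearMap.mulLeftRight ℝ (Matrix m m ℂ) (u k x) (u k x)ᴴ))))) := by rw [LinearMap.comp_assoc, hY, LinearMap.comp_id]
  rw [hEq]
  exact hI

end Summit.QuantumFields.YangMills.BalabanUVNodes.N15.CurvedSpecies

end
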